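import Summits.ValiantsHypothesis.ValiantsHypothesis.Theorems.NNDivisionHard.Negative.BlindCubeIdentity

/-!
# The weak-relief blindness identity: `(1 − |a∩b|)² + α_a|a∖P| + β_a|P∖a|` has nonnegative rank `≤ 2n² + 4n + 1`
# as soon as `α_a ≥ 1` and `β_a ≥ |a|` (crux `FifoMatching.NNDivisionHard`, stmt-ValiantsHypothesis-21181; crux WORKFILE — the Negative-lane port
# `Theorems/NNDivisionHard/Negative/WeakReliefBlind.lean` is staged verbatim with namespace `…Theorems.NNDivisionHardNegative.WeakReliefBlind`)

val-idea-39 g4 (WAVE-6 seat W6-P2, lens «information-complexity / common-information bounds»), critic of record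
val-idea-crit-9 g2.  THE CLIQUE-ROW CAP, SHARPENED.  The blind-cube identity of record (✓ p670959 `BlindCubeIdentity.blind_identity`)
factors `(1 − |a∩b|)² + λ|a||aΔP|` nonnegatively through `2n² + 3n + 2` slots for `λ ≥ max(1, n−1)`, i.e. it needs a RELIEF of
`λ|a| ≥ (n−1)|a|` per unit of Hamming distance `|aΔP|` to the private maximiser `P = a`; every blindness certificate on the record so far
(`Q♮`, `Q∘` ✓ p674104, `Q^c`) pays at least that.  This file proves that the true threshold is TWO ORDERS LOWER and splits by side:

★ `weak_identity` / `weak_rankPlus_le` — for EVERY `n`, every row `a ⊆ [n]` with weights `α_a ≥ 1` (per element of `a∖P`, "missing") and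
`β_a ≥ |a|` (per element of `P∖a`, "extra"), and every column `(b, P)`,
`(1 − |a∩b|)² + α_a·|a∖P| + β_a·|P∖a| = Σ_{idx ∈ WIdx n} weakRow a idx · weakCol (b,P) idx` with `weakRow ≥ 0`, `weakCol ≥ 0` and
`|WIdx n| = 2n² + 4n + 1`; the weights may vary with the row (`α β : Finset (Fin n) → ℤ`).

MECHANISM (an information-cost reading: the column only has to reveal the CLASS `p = |P∩b| ∈ {0, 1, ≥2}` and, per coordinate, O(1) bits).
Write `X = 𝟙_a, Y = 𝟙_b, Π = 𝟙_P, t = |a∩b|, s = |a∩b∩P|, p = |P∩b|`.  Three column classes: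
* `p = 0`:  `E = 1 + Σ_i X_i(1−Π_i)(1−Y_i) + Σ_{i≠m} X_iX_m·Y_iY_m + Σ_{i,m} (1−X_i)X_m·Π_i`   (`a∩b ⊆ a∖P` pays `−t`);
* `p = 1`:  `E = Σ_i (1−X_i)·Π_iY_i + Σ_i X_i(1−Π_i)(1−Y_i) + Σ_{i≠m} X_iX_m·Y_iY_m + Σ_{i,m}(1−X_i)X_m·Π_i`   (the constant `1 = p` is spent);
* `p ≥ 2`:  `(1−t)² = 1 + s(p−2) + (t−s)(t−1) + (t−s)(p−1) − (p−s)t` and the only negative term is charged to the extra elements: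
  `β_a|P∖a| − (p−s)t ≥ Σ_{i,m} (1−X_i)X_m·Π_i(1 − Y_iY_m) ≥ 0` — this is where `β_a ≥ |a|` (one unit per element of `a`, NOT `n−1`) is used;
  `α_a ≥ 1` is used only in the classes `p ≤ 1`.
Seven slot families (`WIdx`): `1·[p≠1]`, `X_i·(…)`, `X_iX_m·Y_iY_m(1−[p≥2]Π_i)` (`i≠m`), `(1−X_i)X_m·Π_i(1−[p≥2]Y_iY_m)`, `(1−X_i)·[p=1]Π_iY_i`,
surplus `(α_a−1)X_i·(1−Π_i)`, `(β_a−|a|)(1−X_i)·Π_i`.  All factors are integers; we state them over `ℤ` and cast.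

CONSEQUENCES (recorded for the W6 seats; nothing below is used in the proofs).
(1) Every passenger whose clique-row recourse dominates `|a∖P| + |a|·|P∖a|` coordinatewise is clique-blind with `O(n²)` slots: this covers
    `Q♮` at `λ = 1` (recourse `|a|·|aΔP|`; the record needed `λ ≥ n−1`), `Q∘`, `Q^c`, the bit-diagonal cube `Q^w` of my 22:14:59Z line
    (`R_k = 2+2w(k−1)−k(k−1) ≥ 1`, `B_k = k(k−1) ≥ k` for `k ≥ 2`), and val-idea-38 g2's weak-relief family
    `WR(λ₁,λ₂) = (1−|a∩b|)² + |a|(λ₁|a∖P| + λ₂|P∖a|)` for ALL `λ₂ ≥ 1`, `λ₁ ≥ 1/|a|` — 38 g2's named obstruction (3) (22:40:27Z: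
    «WR(λ₂) quasi-poly for 1 ≤ λ₂ ≤ n−2?») is settled on the BLIND side: there is no threshold between `1` and `n−1`.
(2) For the C⁺_entry (`LocatedPencilLaw`) enemy hunt (critic N18 (c), «hereditarily blind under pair-pinning»): the residual clique game
    left on a located face needs only UNIT reliefs on the missing side and `|a|` on the extra side — the design space for local /
    sparse-generator cubes (38's `Q_pair`, crit-3's `Z_mix`, degree cubes) is wider by a factor `n` than the `λ ≥ n−1` floor suggested.
(3) LP EVIDENCE beyond the theorem (exact two-phase simplex over the symmetric degree-2 certificate space, per (row-histogram,
    column-histogram) fibre; session folder `qw/fiberlp.py`): the degree-2 fibre LP is feasible for ALL fibres, `n ≤ 8`, already at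
    `(α, β) = (1, 1)` — the PURE HAMMING relief `(1−|a∩b|)² + |aΔP|` — and at `(1, |a|/2)`, `(1/2, |a|)`; it is INFEASIBLE at `α = 0`
    (first failures `n = 6`, row `|a| = 3`).  Conjecture HB (kernel target, not claimed): `rank₊[(1−|a∩b|)² + |aΔP|] ≤ O(n⁴)`.
§4 (rev 4, 2026-08-28T23:57Z; rev 5 = lint-clean, 0 warnings, no statement changed): the SMALL column classes are blind for EVERY `λ ≥ 1` — `smallInv_rankPlus_le`:
`rank₊([|P_{|a|}(π)∩b| ≤ 1]·((1−|a∩b|)² + λ·inv(a;π))) ≤ (n+1)(4n²+4n+1)` for all integers `λ ≥ 1` (the extra-side relief `β = |a|` is needed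
only in the class `|P∩b| ≥ 2`; the untilted small-λ residue `λ ∈ {1,…,|a|}` is exactly that class — memo `SmallLambda39.md`).
§3 (rev 3, 2026-08-28T23:50Z): the `{0,1}`-TILTED rows are blind too — `tiltInv_rankPlus_le`: `rank₊[(1−|a∩b|)² + |(a∖c)∩b| + |(c∖a)∖b| +
λ·inv(c;π)] ≤ (n+1)²(10n²+4n+1)` for all integers `λ ≥ 4n+2` (critic N22 STEP 3, kernel-checked).
§5 (rev 6, 2026-08-29T00:22Z): the LARGE column classes `|P_{|a|}(π)∩b| ≥ 2` are blind as well, at the UNIT weak relief — `big_core`: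
for `|P| = |a|`, `2q(q−1)·((1−|a∩b|)² + |a∖P|) = q(q−1) + u(u−1) + 2(q−1)[(d−v)u + s(d−u)] + 2q(q−1)v(v−1) + 2(q−1)(2q−1)vs + (2(q−1)²−1)s(s−1)`
(`q = |P∩b|`, `s = |a∩P∩b|`, `u = |(P∖a)∩b|`, `v = |(a∖P)∩b|`, `d = |a∖P|`; six ordered-pair families, found by an LP over relabeling-covariant
pairwise certificates and verified exactly for `n ≤ 7` before typing) ⇒ `bigInv_rankPlus_le` (class `q ≥ 2`, every `λ ≥ 1`) and, with §4,
★★★ `inv_rankPlus_le`: `rank₊((1−|a∩b|)² + λ·inv(a;π)) = O(n³)` for EVERY integer `λ ≥ 1`, all rows, ALL columns, untilted — §2's threshold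
`λ ≥ n+1` is gone and the untilted small-λ residue of `SmallLambda39.md` is EMPTY for integer `λ` (Conjecture HB holds in the located setting).
Theorems and concrete data only; VP ≠ VNP is NOT proved; the crux `NNDivisionHard` and C⁺_entry stay OPEN.
-/

-- the mandated summit-side namespace repeats a component by design (single-problem summit)
set_option linter.dupNamespace false

namespace Summit.ValiantsHypothesis.ValiantsHypothesis.Cruxes.NNDivisionHard.WeakReliefBlind39

open Finset
open Summit.ValiantsHypothesis.Theorems.NNDivisionHardNegative.BlindCubeIdentity
  (ind ind_nonneg ind_le_one ind_mul_self ind_inter sum_ind sum_ind_mul sum_ite_eq_sub)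

/-- index type of the factorization: `1 + n + n² + n² + n + n + n = 2n² + 4n + 1` terms (diagonal slots of the third family carry `0`). -/
abbrev WIdx (n : ℕ) := Unit ⊕ Fin n ⊕ (Fin n × Fin n) ⊕ (Fin n × Fin n) ⊕ Fin n ⊕ Fin n ⊕ Fin n

/-- `|WIdx n| = 2n² + 4n + 1`. -/
theorem card_WIdx (n : ℕ) : Fintype.card (WIdx n) = 2 * n ^ 2 + 4 * n + 1 := by
  simp [WIdx, Fintype.card_sum, Fintype.card_prod, Fintype.card_fin]; ring

section IntCore
variable {n : ℕ}

/-- column class indicator `[|P ∩ b| = 1]` -/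
def cOne (b P : Finset (Fin n)) : ℤ := if (P ∩ b).card = 1 then 1 else 0

/-- column class indicator `[|P ∩ b| ≥ 2]` -/
def cTwo (b P : Finset (Fin n)) : ℤ := if 2 ≤ (P ∩ b).card then 1 else 0

/-- row factors `U(a, idx) ≥ 0` (weights `α = α_a`, `β = β_a` of the row) -/
def weakRow (α β : ℤ) (a : Finset (Fin n)) : WIdx n → ℤ
  | Sum.inl _ => 1
  | Sum.inr (Sum.inl i) => ind a i
  | Sum.inr (Sum.inr (Sum.inl (i, m))) => if i = m then 0 else ind a i * ind a m
  | Sum.inr (Sum.inr (Sum.inr (Sum.inl (i, m)))) => (1 - ind a i) * ind a m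
  | Sum.inr (Sum.inr (Sum.inr (Sum.inr (Sum.inl i)))) => 1 - ind a i
  | Sum.inr (Sum.inr (Sum.inr (Sum.inr (Sum.inr (Sum.inl i))))) => (α - 1) * ind a i
  | Sum.inr (Sum.inr (Sum.inr (Sum.inr (Sum.inr (Sum.inr i))))) => (β - (a.card : ℤ)) * (1 - ind a i)

/-- column factors `V((b,P), idx) ≥ 0` (`p = |P ∩ b|`, classes `[p = 1]`, `[p ≥ 2]`) -/
def weakCol (b P : Finset (Fin n)) : WIdx n → ℤ
  | Sum.inl _ => 1 - cOne b P
  | Sum.inr (Sum.inl i) =>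
      (1 - ind P i) * (1 - ind b i) * (1 - cTwo b P) +
        cTwo b P * (ind b i * ind P i * (((P ∩ b).card : ℤ) - 2) + ind b i * (1 - ind P i) * (((P ∩ b).card : ℤ) - 1) +
          (1 - ind P i))
  | Sum.inr (Sum.inr (Sum.inl (i, m))) => ind b i * ind b m * (1 - cTwo b P * ind P i)
  | Sum.inr (Sum.inr (Sum.inr (Sum.inl (i, m)))) => ind P i * (1 - cTwo b P * (ind b i * ind b m))
  | Sum.inr (Sum.inr (Sum.inr (Sum.inr (Sum.inl i)))) => cOne b P * (ind P i * ind b i)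
  | Sum.inr (Sum.inr (Sum.inr (Sum.inr (Sum.inr (Sum.inl i))))) => 1 - ind P i
  | Sum.inr (Sum.inr (Sum.inr (Sum.inr (Sum.inr (Sum.inr i))))) => ind P i

/-- the target entry `(1 − |a∩b|)² + α|a∖P| + β|P∖a|` over `ℤ` (`|a∖P| = |a| − |a∩P|`, `|P∖a| = |P| − |a∩P|`) -/
def weakLHS (α β : ℤ) (a b P : Finset (Fin n)) : ℤ :=
  (1 - ((a ∩ b).card : ℤ)) ^ 2 + α * ((a.card : ℤ) - ((a ∩ P).card : ℤ)) + β * ((P.card : ℤ) - ((a ∩ P).card : ℤ))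

theorem cOne_cases (b P : Finset (Fin n)) : cOne b P = 0 ∨ cOne b P = 1 := by
  unfold cOne; split_ifs <;> simp

theorem cTwo_cases (b P : Finset (Fin n)) : cTwo b P = 0 ∨ cTwo b P = 1 := by
  unfold cTwo; split_ifs <;> simp

/-- row factors are nonnegative as soon as `α ≥ 1` and `β ≥ |a|`. -/
theorem weakRow_nonneg {α β : ℤ} {a : Finset (Fin n)} (hα : 1 ≤ α) (hβ : (a.card : ℤ) ≤ β) (idx : WIdx n) :
    0 ≤ weakRow α β a idx := by
  have h0 := ind_nonneg a; have h1 := ind_le_one a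
  rcases idx with _ | i | ⟨i, m⟩ | ⟨i, m⟩ | i | i | i <;> simp only [weakRow]
  · norm_num
  · exact h0 i
  · split_ifs
    · exact le_rfl
    · exact mul_nonneg (h0 i) (h0 m)
  · exact mul_nonneg (by linarith [h1 i]) (h0 m)
  · linarith [h1 i]
  · exact mul_nonneg (by linarith) (h0 i)
  · exact mul_nonneg (by linarith) (by linarith [h1 i])

/-- column factors are nonnegative (no hypothesis). -/
theorem weakCol_nonneg (b P : Finset (Fin n)) (idx : WIdx n) : 0 ≤ weakCol b P idx := by
  have h0 := ind_nonneg (n := n); have h1 := ind_le_one (n := n)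
  have hpc : (0 : ℤ) ≤ ((P ∩ b).card : ℤ) := Nat.cast_nonneg _
  rcases idx with _ | i | ⟨i, m⟩ | ⟨i, m⟩ | i | i | i <;> simp only [weakCol]
  · rcases cOne_cases b P with h | h <;> rw [h] <;> norm_num
  · unfold cTwo
    split_ifs with h2
    · have h2' : (2 : ℤ) ≤ ((P ∩ b).card : ℤ) := by exact_mod_cast h2
      have t1 : 0 ≤ ind b i * ind P i * (((P ∩ b).card : ℤ) - 2) :=
        mul_nonneg (mul_nonneg (h0 b i) (h0 P i)) (by linarith)
      have t2 : 0 ≤ ind b i * (1 - ind P i) * (((P ∩ b).card : ℤ) - 1) :=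
        mul_nonneg (mul_nonneg (h0 b i) (by linarith [h1 P i])) (by linarith)
      nlinarith [h1 P i, mul_nonneg (by linarith [h1 P i] : (0:ℤ) ≤ 1 - ind P i) (by linarith [h1 b i] : (0:ℤ) ≤ 1 - ind b i)]
    · nlinarith [h1 P i, mul_nonneg (by linarith [h1 P i] : (0:ℤ) ≤ 1 - ind P i) (by linarith [h1 b i] : (0:ℤ) ≤ 1 - ind b i)]
  · refine mul_nonneg (mul_nonneg (h0 b i) (h0 b m)) ?_
    rcases cTwo_cases b P with h | h <;> rw [h] <;> nlinarith [h1 P i, h0 P i]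
  · refine mul_nonneg (h0 P i) ?_
    rcases cTwo_cases b P with h | h <;> rw [h] <;> nlinarith [h1 b i, h0 b i, h1 b m, h0 b m, mul_nonneg (h0 b i) (h0 b m),
      mul_le_one₀ (h1 b i) (h0 b m) (h1 b m)]
  · rcases cOne_cases b P with h | h <;> rw [h] <;> nlinarith [h0 P i, h0 b i, mul_nonneg (h0 P i) (h0 b i)]
  · linarith [h1 P i]
  · exact h0 P i

/-- helper: `X_i Y_i Π_i = 𝟙_{a∩b∩P}`. -/
theorem ind_inter3 (a b P : Finset (Fin n)) (i : Fin n) : ind a i * ind b i * ind P i = ind (a ∩ b ∩ P) i := by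
  rw [ind_inter, ind_inter]

/-- helper: `Σ_i X_i Y_i Π_i = |a ∩ b ∩ P|`. -/
theorem sum_ind_mul3 (a b P : Finset (Fin n)) : ∑ i, ind a i * ind b i * ind P i = ((a ∩ b ∩ P).card : ℤ) := by
  simp_rw [ind_inter3]; exact sum_ind _

/-- the seven blocks of a sum over `WIdx n` -/
theorem sum_WIdx (f : WIdx n → ℤ) :
    ∑ idx, f idx = f (Sum.inl ()) +
      ((∑ i, f (Sum.inr (Sum.inl i))) +
      ((∑ i, ∑ m, f (Sum.inr (Sum.inr (Sum.inl (i, m))))) +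
      ((∑ i, ∑ m, f (Sum.inr (Sum.inr (Sum.inr (Sum.inl (i, m)))))) +
      ((∑ i, f (Sum.inr (Sum.inr (Sum.inr (Sum.inr (Sum.inl i)))))) +
      ((∑ i, f (Sum.inr (Sum.inr (Sum.inr (Sum.inr (Sum.inr (Sum.inl i))))))) +
       (∑ i, f (Sum.inr (Sum.inr (Sum.inr (Sum.inr (Sum.inr (Sum.inr i)))))))))))) := by
  simp only [Fintype.sum_sum_type, Fintype.sum_prod_type, Fintype.sum_unique]

/-- ★★ **THE WEAK-RELIEF IDENTITY, ALL `n`, ALL `α β`** (sorry-free, axioms standard):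
`(1 − |a∩b|)² + α|a∖P| + β|P∖a| = Σ_idx weakRow α β a idx · weakCol b P idx`.
Proof = per-coordinate regrouping (`X_i² = X_i`, `Σ_m X_m = |a|`, `Σ_m X_mY_m = |a∩b|`) down to the defect
`[p=1](p−1) + [p=0]·|a∩b∩P|`, which vanishes in each column class. -/
theorem weak_identity (α β : ℤ) (a b P : Finset (Fin n)) :
    weakLHS α β a b P = ∑ idx : WIdx n, weakRow α β a idx * weakCol b P idx := by
  classical
  rw [sum_WIdx]
  simp only [weakRow, weakCol]
  have hX2 := ind_mul_self a
  have hY2 := ind_mul_self b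
  have hP2 := ind_mul_self P
  have sX := sum_ind a
  have sP := sum_ind P
  have sXY := sum_ind_mul a b
  have sPY := sum_ind_mul P b
  have sXP := sum_ind_mul a P
  have sXYP := sum_ind_mul3 a b P
  set c₁ : ℤ := cOne b P with hc₁
  set c₂ : ℤ := cTwo b P with hc₂
  set p : ℤ := ((P ∩ b).card : ℤ) with hp
  -- family `X_i X_m (m ≠ i)`: closed form per `i`
  have F2 : ∀ i, ∑ m, (if i = m then 0 else ind a i * ind a m) * (ind b i * ind b m * (1 - c₂ * ind P i)) =
      ind a i * ind b i * (1 - c₂ * ind P i) * (((a ∩ b).card : ℤ) - 1) := by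
    intro i
    have : ∀ m, (if i = m then 0 else ind a i * ind a m) * (ind b i * ind b m * (1 - c₂ * ind P i)) =
        if i = m then 0 else ind a i * ind a m * (ind b i * ind b m * (1 - c₂ * ind P i)) := by
      intro m; split_ifs <;> ring
    simp_rw [this]
    rw [sum_ite_eq_sub, hX2, hY2]
    have hs : ∑ m, ind a i * ind a m * (ind b i * ind b m * (1 - c₂ * ind P i)) =
        ind a i * ind b i * (1 - c₂ * ind P i) * ∑ m, ind a m * ind b m := by
      rw [Finset.mul_sum]
      exact Finset.sum_congr rfl fun m _ => by ring
    rw [hs, sXY]; ring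
  -- family `(1 − X_i) X_m` (all `m`): closed form per `i`
  have F3 : ∀ i, ∑ m, (1 - ind a i) * ind a m * (ind P i * (1 - c₂ * (ind b i * ind b m))) =
      (1 - ind a i) * ind P i * ((a.card : ℤ) - c₂ * ind b i * ((a ∩ b).card : ℤ)) := by
    intro i
    have hs : ∑ m, (1 - ind a i) * ind a m * (ind P i * (1 - c₂ * (ind b i * ind b m))) =
        (1 - ind a i) * ind P i * (∑ m, ind a m - c₂ * ind b i * ∑ m, ind a m * ind b m) := by
      rw [Finset.mul_sum, ← Finset.sum_sub_distrib, Finset.mul_sum]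
      exact Finset.sum_congr rfl fun m _ => by ring
    rw [hs, sX, sXY]
  simp_rw [F2, F3]
  -- per-coordinate polynomial
  have per : ∀ i,
      ind a i * ((1 - ind P i) * (1 - ind b i) * (1 - c₂) +
          c₂ * (ind b i * ind P i * (p - 2) + ind b i * (1 - ind P i) * (p - 1) + (1 - ind P i))) +
      (ind a i * ind b i * (1 - c₂ * ind P i) * (((a ∩ b).card : ℤ) - 1) +
      ((1 - ind a i) * ind P i * ((a.card : ℤ) - c₂ * ind b i * ((a ∩ b).card : ℤ)) +
      ((1 - ind a i) * (c₁ * (ind P i * ind b i)) +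
      ((α - 1) * ind a i * (1 - ind P i) +
       (β - (a.card : ℤ)) * (1 - ind a i) * ind P i)))) =
      α * ind a i + β * ind P i - (α + β) * (ind a i * ind P i)
        + (c₂ * p + ((a ∩ b).card : ℤ) - 2) * (ind a i * ind b i)
        + (c₁ - c₂ * ((a ∩ b).card : ℤ)) * (ind P i * ind b i)
        + (1 - c₁ - c₂) * (ind a i * ind b i * ind P i) := by
    intro i
    ring
  rw [← Finset.sum_add_distrib, ← Finset.sum_add_distrib, ← Finset.sum_add_distrib, ← Finset.sum_add_distrib,
    ← Finset.sum_add_distrib]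
  rw [Finset.sum_congr rfl (fun i _ => per i)]
  rw [Finset.sum_add_distrib, Finset.sum_add_distrib, Finset.sum_add_distrib, Finset.sum_sub_distrib,
    Finset.sum_add_distrib, ← Finset.mul_sum, ← Finset.mul_sum, ← Finset.mul_sum, ← Finset.mul_sum, ← Finset.mul_sum,
    ← Finset.mul_sum, sX, sP, sXP, sXY, sPY, sXYP, weakLHS]
  -- the defect `c₁(p−1) + (1−c₁−c₂)s` vanishes in each column class
  have hsub : a ∩ b ∩ P ⊆ P ∩ b := by
    intro x hx
    simp only [Finset.mem_inter] at hx ⊢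
    exact ⟨hx.2, hx.1.2⟩
  have hs_le : ((a ∩ b ∩ P).card : ℤ) ≤ p := by rw [hp]; exact_mod_cast Finset.card_le_card hsub
  have hs0 : (0 : ℤ) ≤ ((a ∩ b ∩ P).card : ℤ) := Nat.cast_nonneg _
  obtain h0 | h1 | h2 : (P ∩ b).card = 0 ∨ (P ∩ b).card = 1 ∨ 2 ≤ (P ∩ b).card := by omega
  · have e1 : c₁ = 0 := by rw [hc₁, cOne, h0]; simp
    have e2 : c₂ = 0 := by rw [hc₂, cTwo, h0]; simp
    have e3 : p = 0 := by rw [hp, h0]; simp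
    have e4 : ((a ∩ b ∩ P).card : ℤ) = 0 := by linarith
    rw [e1, e2, e4, e3]; ring
  · have e1 : c₁ = 1 := by rw [hc₁, cOne, h1]; simp
    have e2 : c₂ = 0 := by rw [hc₂, cTwo, h1]; simp
    have e3 : p = 1 := by rw [hp, h1]; simp
    rw [e1, e2, e3]; ring
  · have e1 : c₁ = 0 := by rw [hc₁, cOne]; simp; omega
    have e2 : c₂ = 1 := by rw [hc₂, cTwo]; simp [h2]
    rw [e1, e2]; ring
end IntCore

/-- ★★ **`rank₊ ≤ 2n² + 4n + 1` for the weak relief**: for every `n` and all row weights `α β : Finset (Fin n) → ℤ` with `1 ≤ α a` and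
`|a| ≤ β a` there are NONNEGATIVE real `U : Finset (Fin n) → WIdx n → ℝ`, `V : Finset (Fin n) × Finset (Fin n) → WIdx n → ℝ` with
`(1 − |a∩b|)² + α_a(|a| − |a∩P|) + β_a(|P| − |a∩P|) = Σ_idx U a idx · V (b,P) idx` for all `a b P`. -/
theorem weak_rankPlus_le (n : ℕ) (α β : Finset (Fin n) → ℤ) (hα : ∀ a, 1 ≤ α a) (hβ : ∀ a, (a.card : ℤ) ≤ β a) :
    ∃ (U : Finset (Fin n) → WIdx n → ℝ) (V : Finset (Fin n) × Finset (Fin n) → WIdx n → ℝ),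
      (∀ a idx, 0 ≤ U a idx) ∧ (∀ bP idx, 0 ≤ V bP idx) ∧
      ∀ a b P : Finset (Fin n),
        ((1 : ℝ) - ((a ∩ b).card : ℝ)) ^ 2
            + (α a : ℝ) * ((a.card : ℝ) - ((a ∩ P).card : ℝ)) + (β a : ℝ) * ((P.card : ℝ) - ((a ∩ P).card : ℝ))
          = ∑ idx, U a idx * V (b, P) idx := by
  refine ⟨fun a idx => (weakRow (α a) (β a) a idx : ℝ), fun bP idx => (weakCol bP.1 bP.2 idx : ℝ),
    fun a idx => Int.cast_nonneg_iff.mpr (weakRow_nonneg (hα a) (hβ a) idx) |>.trans_eq (by simp),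
    fun bP idx => Int.cast_nonneg_iff.mpr (weakCol_nonneg bP.1 bP.2 idx) |>.trans_eq (by simp), ?_⟩
  intro a b P
  have h := congrArg (fun z : ℤ => (z : ℝ)) (weak_identity (α a) (β a) a b P)
  simp only [weakLHS, Int.cast_add, Int.cast_pow, Int.cast_sub, Int.cast_one, Int.cast_mul, Int.cast_natCast,
    Int.cast_sum] at h
  simpa using h

/-- ★ **THE RECORD'S IDENTITY AT `λ = 1`**: `(1 − |a∩b|)² + λ|a|·|aΔP|` is an explicit nonnegative factorization of size `2n² + 4n + 1`
for EVERY integer `λ ≥ 1` (✓ p670959 needed `λ ≥ n − 1`) — the instance `α_a = β_a = λ|a|` for `a ≠ ∅` (`α_∅ = β_∅ = 1`). -/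
theorem blindCube_rankPlus_le_of_one_le (n : ℕ) (lam : ℤ) (hlam : 1 ≤ lam) :
    ∃ (U : Finset (Fin n) → WIdx n → ℝ) (V : Finset (Fin n) × Finset (Fin n) → WIdx n → ℝ),
      (∀ a idx, 0 ≤ U a idx) ∧ (∀ bP idx, 0 ≤ V bP idx) ∧
      ∀ a b P : Finset (Fin n),
        ((1 : ℝ) - ((a ∩ b).card : ℝ)) ^ 2
            + (lam : ℝ) * ((a.card : ℝ) * ((a.card : ℝ) + (P.card : ℝ) - 2 * ((a ∩ P).card : ℝ)))
          = ∑ idx, U a idx * V (b, P) idx := by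
  classical
  -- weights: `β_a = λ|a|` (so `β_∅ = 0`), `α_a = λ|a|` for `a ≠ ∅` and `α_∅ = 1` (it multiplies `|∅∖P| = 0`)
  let wα : Finset (Fin n) → ℤ := fun a => if a = ∅ then 1 else lam * (a.card : ℤ)
  let wβ : Finset (Fin n) → ℤ := fun a => lam * (a.card : ℤ)
  have hw1 : ∀ a, 1 ≤ wα a := by
    intro a; simp only [wα]; split_ifs with h
    · exact le_rfl
    · have : 1 ≤ a.card := Finset.card_pos.2 (Finset.nonempty_iff_ne_empty.2 h)
      have : (1 : ℤ) ≤ (a.card : ℤ) := by exact_mod_cast this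
      nlinarith
  have hw2 : ∀ a, (a.card : ℤ) ≤ wβ a := by
    intro a; simp only [wβ]
    have : (0 : ℤ) ≤ (a.card : ℤ) := Nat.cast_nonneg _
    nlinarith
  obtain ⟨U, V, hU, hV, hfac⟩ := weak_rankPlus_le n wα wβ hw1 hw2
  refine ⟨U, V, hU, hV, fun a b P => ?_⟩
  rw [← hfac a b P]
  by_cases h : a = ∅
  · subst h; simp [wα, wβ]
  · simp only [wα, wβ, h, if_false, Int.cast_mul, Int.cast_natCast]; ring


/-! ## §2  First located application: the UNTILTED diagonal rows of the permutahedral passenger `Q^Π_λ` are blind for `λ ≥ n+1`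

THE OPEN QUESTION OF WAVE 6 (critic of record val-idea-crit-9 g2, 2026-08-28T22:52:44Z; raised by val-idea-41 g3 22:50:44Z):
is the diagonal permutahedron `Q^Π_λ = conv{−λ·diag π : π ∈ S_n}` blind to located pencils?  By crit-9's reduction the untilted
clique row `a` has located-pencil slack `M_λ(a; b, π) = (1 − |a∩b|)² + λ·inv(a;π)` at the column `(b, π)`, where
`inv(a;π) = #{(l ∈ a, l′ ∉ a) : π(l′) < π(l)}` is the assignment recourse of `π` against the row's private optimum
(«a occupies the first |a| positions»); 41 g3: «KW/fooling give nothing»; crit-9: «(P-side) a corruption bound rank₊ M_{a,0} ≥ 2^{n^ε}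
— then Q^Π_λ is DECIDED».  ★ `permInv_identity` / `permInv_rankPlus_le` below CLOSE THE P-SIDE FOR THE UNTILTED ROWS when `λ ≥ n+1`:
`rank₊ M_λ ≤ (n+1)·(4n² + 4n + 1)`, by an explicit integer certificate whose LOCATED SET is the initial segment `P_k(π) = {l : π(l) < k}`,
`k = |a|` — the weak-relief identity of §1 at `(α, β) = (1, |a|)` supplies `(1−|a∩b|)² + (k+1)·d` (`d = |a ∖ P_k(π)| = |P_k(π) ∖ a|`), and
`λ·inv(a;π) − (k+1)·d = λ·(E₁ + E₂) + (λ − k − 1)·d² + (k+1)·d(d−1)` is a sum of nonnegative row×column products because EVERY pair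
`(l ∈ a∖P, l′ ∈ P∖a)` is an inversion (`d²` of them) and at `d = 1` the single boundary swap already pays `λ ≥ k+1 = α + β`
(`E₁`, `E₂` = inversions inside `Pᶜ×Pᶜ` and `P×P`; pairs `P × Pᶜ` are never inversions).  The threshold is where it should be:
for `λ ≤ k` the certificate is short at the boundary-swap columns, and `λ ∈ {1, …, |a|}` is what remains of the untilted question.
What this does NOT do: tilted rows `(a, σ)` (slack `(1−|a∩b|)² + Σ_i(σ_i⁺(1−b_i) + σ_i⁻ b_i) + λ·Σ_{l,l′}(v_l − v_{l′})⁺[π(l′)<π(l)]`,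
`v = 𝟙_a + σ`) are NOT covered, so `LocatedPencilLaw` is neither refuted nor confirmed at `Q^Π`; paper reduction for R1 (threshold
rounding `ξ ∈ [0,1]`, `u_l = min(σ_l⁻,1)` on `a`, `w_l′ = min(σ_l′⁺,1)` off `a`, antithetic coupling `E_ξ[(1−u−w)⁺-pattern]` exact): it
suffices to factor the `{0,1}`-tilt family `(1 − |a₀∩b|)² + |c ∖ b| + λ·#{(l ∈ a₀, l′ ∉ a₀ ∪ c) : π(l′) < π(l)}` over rows `(a₀, c)`
(`c ⊆ [n]∖a₀` the raised outsiders; cancelled elements of `a` only add cone terms) — `c = ∅` is this section, `c = [n]∖a₀` is cone by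
`t − t_min = |a₀ᶜ ∩ bᶜ|` on size blocks; the mixed case is open.  VP ≠ VNP is NOT proved. -/

section Permutahedron
variable {n : ℕ}

/-- indicator of the located initial segment: `[π(l) < k]` -/
def pInd (π : Equiv.Perm (Fin n)) (k : ℕ) (l : Fin n) : ℤ := if (π l : ℕ) < k then 1 else 0

/-- the located set `P_k(π) = {l : π(l) < k}` -/
def posLT (π : Equiv.Perm (Fin n)) (k : ℕ) : Finset (Fin n) := Finset.univ.filter fun l => (π l : ℕ) < k

/-- inversion indicator `[π(l′) < π(l)]` -/
def invInd (π : Equiv.Perm (Fin n)) (l l' : Fin n) : ℤ := if π l' < π l then 1 else 0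

/-- the assignment recourse of the untilted row `a` at the permutation `π`: `inv(a;π) = #{(l ∈ a, l′ ∉ a) : π(l′) < π(l)}`
(written as a double indicator sum over `ℤ`). -/
def inv (a : Finset (Fin n)) (π : Equiv.Perm (Fin n)) : ℤ := ∑ l, ∑ l', ind a l * (1 - ind a l') * invInd π l l'

theorem ind_posLT (π : Equiv.Perm (Fin n)) (k : ℕ) (l : Fin n) : ind (posLT π k) l = pInd π k l := by
  simp [ind, posLT, pInd]

theorem pInd_nonneg (π : Equiv.Perm (Fin n)) (k : ℕ) (l : Fin n) : 0 ≤ pInd π k l := by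
  unfold pInd; split_ifs <;> norm_num

theorem pInd_le_one (π : Equiv.Perm (Fin n)) (k : ℕ) (l : Fin n) : pInd π k l ≤ 1 := by
  unfold pInd; split_ifs <;> norm_num

theorem pInd_mul_self (π : Equiv.Perm (Fin n)) (k : ℕ) (l : Fin n) : pInd π k l * pInd π k l = pInd π k l := by
  unfold pInd; split_ifs <;> norm_num

theorem invInd_nonneg (π : Equiv.Perm (Fin n)) (l l' : Fin n) : 0 ≤ invInd π l l' := by
  unfold invInd; split_ifs <;> norm_num

/-- `|P_k(π)| = k` for `k ≤ n`. -/
theorem card_posLT (π : Equiv.Perm (Fin n)) {k : ℕ} (hk : k ≤ n) : (posLT π k).card = k := by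
  have h1 : posLT π k = (Finset.univ.filter fun m : Fin n => (m : ℕ) < k).map π.symm.toEmbedding := by
    ext l
    simp only [posLT, Finset.mem_filter, Finset.mem_univ, true_and, Finset.mem_map, Equiv.coe_toEmbedding]
    constructor
    · intro h; exact ⟨π l, h, by simp⟩
    · rintro ⟨m, hm, rfl⟩; simpa using hm
  rw [h1, Finset.card_map]
  have h2 : (Finset.univ.filter fun m : Fin n => (m : ℕ) < k).card = Fintype.card {m : Fin n // (m : ℕ) < k} :=
    (Fintype.card_subtype _).symm
  rw [h2]
  exact Fintype.card_fin_lt_of_le hk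

/-- per-pair location of inversions relative to `P = P_k(π)`: a pair `(l ∉ P, l′ ∈ P)` is ALWAYS an inversion, a pair
`(l ∈ P, l′ ∉ P)` NEVER is. -/
theorem invInd_split (π : Equiv.Perm (Fin n)) (k : ℕ) (l l' : Fin n) :
    invInd π l l' = (1 - pInd π k l) * pInd π k l' +
      ((1 - pInd π k l) * (1 - pInd π k l') + pInd π k l * pInd π k l') * invInd π l l' := by
  unfold invInd pInd
  have hll' : π l' < π l ↔ ((π l' : ℕ)) < (π l : ℕ) := Fin.lt_def
  by_cases h1 : (π l : ℕ) < k <;> by_cases h2 : (π l' : ℕ) < k <;> by_cases h3 : π l' < π l <;>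
    simp only [h1, h2, h3, if_true, if_false] <;> (try norm_num) <;> (rw [hll'] at h3; omega)

/-- row factors of the two recourse families are nonnegative when `λ ≥ |a| + 1`. -/
theorem recRow_nonneg {lam : ℤ} {a : Finset (Fin n)} (hlam : (a.card : ℤ) + 1 ≤ lam) (l l₂ : Fin n) :
    0 ≤ lam * (ind a l * (1 - ind a l₂)) ∧
      0 ≤ ind a l * ind a l₂ * (lam - ((a.card : ℤ) + 1) * (if l = l₂ then 1 else 0)) := by
  have h0 := ind_nonneg a; have h1 := ind_le_one a
  have hk : (0 : ℤ) ≤ (a.card : ℤ) := Nat.cast_nonneg _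
  refine ⟨mul_nonneg (by linarith) (mul_nonneg (h0 l) (by linarith [h1 l₂])), mul_nonneg (mul_nonneg (h0 l) (h0 l₂)) ?_⟩
  split_ifs <;> linarith

/-- ★★ **THE UNTILTED PERMUTAHEDRAL IDENTITY** (all `n`, all `λ`, every row `a` and column `(b, π)`; sorry-free):
`(1 − |a∩b|)² + λ·inv(a;π) = Σ_WIdx weakRow 1 |a| a · weakCol b P_{|a|}(π)`   (weak relief located at the initial segment)
` + Σ_{l,l′} λ X_l(1−X_{l′}) · ([l,l′ ∉ P] + [l,l′ ∈ P])[π(l′)<π(l)]`   (inversions inside `Pᶜ×Pᶜ` and `P×P`)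
` + Σ_{l,l₂} X_l X_{l₂}(λ − (|a|+1)[l=l₂]) · [l ∉ P][l₂ ∉ P]`   (`λd² − (k+1)d`, paid by the `d²` boundary inversions). -/
theorem permInv_identity (lam : ℤ) (a b : Finset (Fin n)) (π : Equiv.Perm (Fin n)) :
    (1 - ((a ∩ b).card : ℤ)) ^ 2 + lam * inv a π =
      (∑ idx : WIdx n, weakRow 1 (a.card : ℤ) a idx * weakCol b (posLT π a.card) idx) +
      ((∑ l, ∑ l', (lam * (ind a l * (1 - ind a l'))) *
          ((((1 - pInd π a.card l) * (1 - pInd π a.card l') + pInd π a.card l * pInd π a.card l') * invInd π l l'))) +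
       (∑ l, ∑ l₂, (ind a l * ind a l₂ * (lam - ((a.card : ℤ) + 1) * (if l = l₂ then 1 else 0))) *
          ((1 - pInd π a.card l) * (1 - pInd π a.card l₂)))) := by
  classical
  rw [← weak_identity]
  simp only [weakLHS]
  have hkn : a.card ≤ n := by simpa using Finset.card_le_univ a
  have hPk : ((posLT π a.card).card : ℤ) = (a.card : ℤ) := by exact_mod_cast card_posLT π hkn
  have sXP : ∑ l, ind a l * pInd π a.card l = ((a ∩ posLT π a.card).card : ℤ) := by
    simp_rw [← ind_posLT]; exact sum_ind_mul a _
  have sP : ∑ l, pInd π a.card l = ((posLT π a.card).card : ℤ) := by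
    simp_rw [← ind_posLT]; exact sum_ind _
  have sX := sum_ind a
  have hX2 := ind_mul_self a
  have hP2 := pInd_mul_self π a.card
  -- (1) the recourse splits along `P`
  have hinv : inv a π =
      (∑ l, ind a l * (1 - pInd π a.card l)) * (∑ l', (1 - ind a l') * pInd π a.card l') +
      ∑ l, ∑ l', ind a l * (1 - ind a l') *
        (((1 - pInd π a.card l) * (1 - pInd π a.card l') + pInd π a.card l * pInd π a.card l') * invInd π l l') := by
    unfold inv
    rw [Finset.sum_mul_sum, ← Finset.sum_add_distrib]
    refine Finset.sum_congr rfl fun l _ => ?_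
    rw [← Finset.sum_add_distrib]
    refine Finset.sum_congr rfl fun l' _ => ?_
    conv_lhs => rw [invInd_split π a.card l l']
    ring
  -- (2) the boundary family is `λ x² − (k+1) x`, `x = Σ X_l (1 − Π_l)`
  have hbd : ∑ l, ∑ l₂, (ind a l * ind a l₂ * (lam - ((a.card : ℤ) + 1) * (if l = l₂ then 1 else 0))) *
        ((1 - pInd π a.card l) * (1 - pInd π a.card l₂)) =
      lam * (∑ l, ind a l * (1 - pInd π a.card l)) ^ 2 - ((a.card : ℤ) + 1) * ∑ l, ind a l * (1 - pInd π a.card l) := by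
    have e : ∀ l l₂, (ind a l * ind a l₂ * (lam - ((a.card : ℤ) + 1) * (if l = l₂ then 1 else 0))) *
        ((1 - pInd π a.card l) * (1 - pInd π a.card l₂)) =
        lam * ((ind a l * (1 - pInd π a.card l)) * (ind a l₂ * (1 - pInd π a.card l₂))) -
          ((a.card : ℤ) + 1) * (if l = l₂ then (ind a l * (1 - pInd π a.card l)) * (ind a l₂ * (1 - pInd π a.card l₂)) else 0) := by
      intro l l₂; split_ifs <;> ring
    have idem : ∀ l, (ind a l * (1 - pInd π a.card l)) * (ind a l * (1 - pInd π a.card l)) = ind a l * (1 - pInd π a.card l) := by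
      intro l
      linear_combination ((1 - pInd π a.card l) * (1 - pInd π a.card l)) * hX2 l + ind a l * hP2 l
    have inner : ∀ l, ∑ l₂, (ind a l * ind a l₂ * (lam - ((a.card : ℤ) + 1) * (if l = l₂ then 1 else 0))) *
        ((1 - pInd π a.card l) * (1 - pInd π a.card l₂)) =
        lam * ((ind a l * (1 - pInd π a.card l)) * ∑ l₂, ind a l₂ * (1 - pInd π a.card l₂)) -
          ((a.card : ℤ) + 1) * (ind a l * (1 - pInd π a.card l)) := by
      intro l
      rw [Finset.sum_congr rfl (fun l₂ _ => e l l₂), Finset.sum_sub_distrib, ← Finset.mul_sum, ← Finset.mul_sum,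
        ← Finset.mul_sum, Finset.sum_ite_eq]
      simp only [Finset.mem_univ, if_true]
      rw [idem l]
    rw [Finset.sum_congr rfl (fun l _ => inner l), Finset.sum_sub_distrib, ← Finset.mul_sum, ← Finset.mul_sum,
      ← Finset.sum_mul, sq]
  have hE : ∑ l, ∑ l', (lam * (ind a l * (1 - ind a l'))) *
        ((((1 - pInd π a.card l) * (1 - pInd π a.card l') + pInd π a.card l * pInd π a.card l') * invInd π l l')) =
      lam * ∑ l, ∑ l', ind a l * (1 - ind a l') *
        (((1 - pInd π a.card l) * (1 - pInd π a.card l') + pInd π a.card l * pInd π a.card l') * invInd π l l') := by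
    rw [Finset.mul_sum]
    refine Finset.sum_congr rfl fun l _ => ?_
    rw [Finset.mul_sum]
    exact Finset.sum_congr rfl fun l' _ => by ring
  rw [hinv, hbd, hE]
  -- (3) bookkeeping: x = k − |a∩P| = y
  have hx : ∑ l, ind a l * (1 - pInd π a.card l) = (a.card : ℤ) - ((a ∩ posLT π a.card).card : ℤ) := by
    rw [← sX, ← sXP, ← Finset.sum_sub_distrib]
    exact Finset.sum_congr rfl fun l _ => by ring
  have hy : ∑ l', (1 - ind a l') * pInd π a.card l' = ((posLT π a.card).card : ℤ) - ((a ∩ posLT π a.card).card : ℤ) := by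
    rw [← sP, ← sXP, ← Finset.sum_sub_distrib]
    exact Finset.sum_congr rfl fun l _ => by ring
  rw [hx, hy, hPk]
  ring

/-- index type of the packaged certificate: a row-size class `k ∈ {0,…,n}` times (weak-relief slots ⊕ two `n × n` recourse families);
`|PIdx n| = (n+1)(4n² + 4n + 1)`. -/
abbrev PIdx (n : ℕ) := Fin (n + 1) × (WIdx n ⊕ (Fin n × Fin n) ⊕ (Fin n × Fin n))

theorem card_PIdx (n : ℕ) : Fintype.card (PIdx n) = (n + 1) * (4 * n ^ 2 + 4 * n + 1) := by
  simp [PIdx, WIdx, Fintype.card_sum, Fintype.card_prod, Fintype.card_fin]; ring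

/-- row factors at size class `k` -/
def permRow (lam : ℤ) (a : Finset (Fin n)) : WIdx n ⊕ (Fin n × Fin n) ⊕ (Fin n × Fin n) → ℤ
  | Sum.inl idx => weakRow 1 (a.card : ℤ) a idx
  | Sum.inr (Sum.inl (l, l')) => lam * (ind a l * (1 - ind a l'))
  | Sum.inr (Sum.inr (l, l₂)) => ind a l * ind a l₂ * (lam - ((a.card : ℤ) + 1) * (if l = l₂ then 1 else 0))

/-- column factors at size class `k` (located set `P_k(π)`) -/
def permCol (b : Finset (Fin n)) (π : Equiv.Perm (Fin n)) (k : ℕ) : WIdx n ⊕ (Fin n × Fin n) ⊕ (Fin n × Fin n) → ℤ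
  | Sum.inl idx => weakCol b (posLT π k) idx
  | Sum.inr (Sum.inl (l, l')) => ((1 - pInd π k l) * (1 - pInd π k l') + pInd π k l * pInd π k l') * invInd π l l'
  | Sum.inr (Sum.inr (l, l₂)) => (1 - pInd π k l) * (1 - pInd π k l₂)

theorem permRow_nonneg {lam : ℤ} {a : Finset (Fin n)} (hlam : (a.card : ℤ) + 1 ≤ lam) (s) : 0 ≤ permRow lam a s := by
  rcases s with idx | ⟨l, l'⟩ | ⟨l, l₂⟩ <;> simp only [permRow]
  · exact weakRow_nonneg le_rfl le_rfl idx
  · exact (recRow_nonneg hlam l l').1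
  · exact (recRow_nonneg hlam l l₂).2

theorem permCol_nonneg (b : Finset (Fin n)) (π : Equiv.Perm (Fin n)) (k : ℕ) (s) : 0 ≤ permCol b π k s := by
  have h0 := pInd_nonneg π k; have h1 := pInd_le_one π k
  rcases s with idx | ⟨l, l'⟩ | ⟨l, l₂⟩ <;> simp only [permCol]
  · exact weakCol_nonneg b _ idx
  · refine mul_nonneg ?_ (invInd_nonneg π l l')
    nlinarith [h0 l, h1 l, h0 l', h1 l', mul_nonneg (h0 l) (h0 l'),
      mul_nonneg (by linarith [h1 l] : (0:ℤ) ≤ 1 - pInd π k l) (by linarith [h1 l'] : (0:ℤ) ≤ 1 - pInd π k l')]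
  · exact mul_nonneg (by linarith [h1 l]) (by linarith [h1 l₂])

/-- the identity in packaged (class-free) form for ONE row -/
theorem permInv_identity' (lam : ℤ) (a b : Finset (Fin n)) (π : Equiv.Perm (Fin n)) :
    (1 - ((a ∩ b).card : ℤ)) ^ 2 + lam * inv a π = ∑ s, permRow lam a s * permCol b π a.card s := by
  rw [permInv_identity lam a b π]
  simp only [Fintype.sum_sum_type, Fintype.sum_prod_type, permRow, permCol]

/-- ★★ **`rank₊[(1 − |a∩b|)² + λ·inv(a;π)] ≤ (n+1)(4n² + 4n + 1)` for every `n` and every integer `λ ≥ n + 1`**: nonnegative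
`U : Finset (Fin n) → PIdx n → ℝ`, `V : Finset (Fin n) × Equiv.Perm (Fin n) → PIdx n → ℝ` with
`(1 − |a∩b|)² + λ·inv(a;π) = Σ_s U a s · V (b,π) s` for ALL rows `a ⊆ [n]` and columns `(b, π)` — the untilted diagonal rows of
`Q^Π_λ` carry NO corruption / hyperplane-separation lower bound beyond `O(n³)`. -/
theorem permInv_rankPlus_le (n : ℕ) (lam : ℤ) (hlam : (n : ℤ) + 1 ≤ lam) :
    ∃ (U : Finset (Fin n) → PIdx n → ℝ) (V : Finset (Fin n) × Equiv.Perm (Fin n) → PIdx n → ℝ),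
      (∀ a s, 0 ≤ U a s) ∧ (∀ bπ s, 0 ≤ V bπ s) ∧
      ∀ (a b : Finset (Fin n)) (π : Equiv.Perm (Fin n)),
        ((1 : ℝ) - ((a ∩ b).card : ℝ)) ^ 2 + (lam : ℝ) * (inv a π : ℝ) = ∑ s, U a s * V (b, π) s := by
  classical
  refine ⟨fun a s => if (s.1 : ℕ) = a.card then (permRow lam a s.2 : ℝ) else 0,
    fun bπ s => (permCol bπ.1 bπ.2 (s.1 : ℕ) s.2 : ℝ), ?_, ?_, ?_⟩
  · intro a s
    dsimp only
    split_ifs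
    · have hkn : a.card ≤ n := by simpa using Finset.card_le_univ a
      have hkn' : (a.card : ℤ) ≤ n := by exact_mod_cast hkn
      have : (a.card : ℤ) + 1 ≤ lam := by linarith
      exact_mod_cast permRow_nonneg this s.2
    · exact le_rfl
  · intro bπ s
    dsimp only
    exact_mod_cast permCol_nonneg bπ.1 bπ.2 _ s.2
  · intro a b π
    have hkn : a.card < n + 1 := by
      have : a.card ≤ n := by simpa using Finset.card_le_univ a
      omega
    have h := congrArg (fun z : ℤ => (z : ℝ)) (permInv_identity' lam a b π)
    simp only [Int.cast_add, Int.cast_pow, Int.cast_sub, Int.cast_one, Int.cast_mul, Int.cast_natCast, Int.cast_sum] at h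
    rw [h, Fintype.sum_prod_type]
    rw [Finset.sum_eq_single (⟨a.card, hkn⟩ : Fin (n + 1))]
    · simp
    · intro k _ hk
      have : (k : ℕ) ≠ a.card := fun e => hk (Fin.ext e)
      simp [this]
    · intro h; exact absurd (Finset.mem_univ _) h

end Permutahedron

/-! ## §3  The `{0,1}`-TILTED rows of `Q^Π_λ` are blind too — critic N22 STEP 3 (2026-08-28T23:07:41Z) in the kernel:
`rank₊ S ≤ (n+1)²·(10n² + 4n + 1)` for EVERY `n` and every integer `λ ≥ 4n + 2`, where for rows `(a, c)` (`a` = the clique,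
`c` = the support of the rounded tilt `v = 𝟙_a + σ`, so `a∩c` live, `c∖a` ghosts, `a∖c` cancelled) and columns `(b, π)`
`S(a,c;b,π) = (1 − |a∩b|)² + |(a∖c)∩b| + |(c∖a)∖b| + λ·inv(c;π)`,  `inv(c;π) = #{(l ∈ c, l′ ∉ c) : π(l′) < π(l)}`
(N22's `S` verbatim: off-clique junk `(1−|a∩b|)²`-completion, the two tilt charges, the bubble-sort recourse of STEP 1).
★★★ `tilt_identity` / `tilt_identity'` / `tiltInv_rankPlus_le` (sorry-free).  MECHANISM.  The column announces nothing but reads the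
row's announced classes `(k, m) = (|c|, |c∖a|)`; the located set is again the initial segment `P = P_k(π)`; Lemma B (`inv_split`):
`inv(c;π) = |c∖P|·|P∖c| + E` (every pair `(c∖P) × (P∖c)` is an inversion).  With `D = |b∩P| − m − 1` and `κ = [D ≥ 0]` the core set
identity `tilt_core` (generic `P` with `|P| = |c|`) writes `S − λE` as SEVENTEEN nonnegative row×column families (`certG`: 10 pair
families over `(l,l′)`, 4 single families, 1 constant), e.g. the UDISJ part `(1−|a∩b|)²` is linearised against the live defect
`x_o + y_o` (`x_o = |a∩c∩bᶜ∩Pᶜ|`, `y_o = |a∩c∩b∩Pᶜ|`) when `κ = 1` and paid by `−D ≥ 1` when `κ = 0`; the recourse `λ·d_out·d_in`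
(`d_out = |c∖P| = d_in = |P∖c|`) pays `2n·u_P + …` per unit, whence the threshold `λ ≥ 4n + 2` (not optimised; the paper value is
`λ ≳ 2n`).  PROOF TECHNIQUE (reusable): every coordinate sum is expanded into the 16 Venn cells of `(a, c, b, P)` (`sum_expand`), after
which the identity is ONE `linear_combination` over `ℤ[cells, λ, κ]` with the single relation `|c| = |P|`; exact arithmetic pre-check
`t3/check_merged.py` (all `(a,c,b)`, all `π ∈ S_3`, generic `P` for `n ≤ 4`: 0 mismatches).  CONSEQUENCE for the record: together with
N22 STEP 0–2 (crit-9) this is the P-side certificate that the `{0,1}`-tilt layer of `LocatedPencilLaw`'s enemy `Q^Π_λ` carries no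
corruption bound — `xc`-blindness of the tilted located pencil with `(n+1)²(10n²+4n+1)` slots per class-pair, uniformly in `λ ≥ 4n+2`.
VP ≠ VNP is NOT proved; `NNDivisionHard` stays OPEN; this section supports the NEGATIVE edge `LocatedPencilLaw` ↦ refuted-misstated. -/

section Tilt
variable {n : ℕ}

theorem ind01 (a : Finset (Fin n)) (l : Fin n) : ind a l = 0 ∨ ind a l = 1 := by
  unfold ind; split_ifs <;> simp

theorem ind_sdiff (a c : Finset (Fin n)) (l : Fin n) : ind (a \ c) l = ind a l * (1 - ind c l) := by
  unfold ind; by_cases ha : l ∈ a <;> by_cases hc : l ∈ c <;> simp [ha, hc, Finset.mem_sdiff]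

/-- live `a∩c`, ghost `c∖a`, cancelled `a∖c`, light `[n]∖c` indicators of the row `(a,c)` -/
def lv (a c : Finset (Fin n)) (l : Fin n) : ℤ := ind a l * ind c l
def gh (a c : Finset (Fin n)) (l : Fin n) : ℤ := ind c l * (1 - ind a l)
def ca (a c : Finset (Fin n)) (l : Fin n) : ℤ := ind a l * (1 - ind c l)
def lt (c : Finset (Fin n)) (l : Fin n) : ℤ := 1 - ind c l
/-- off-diagonal indicator `[l ≠ l′]` -/
def offd (l l' : Fin n) : ℤ := if l = l' then 0 else 1

theorem lv_nonneg (a c : Finset (Fin n)) (l) : 0 ≤ lv a c l := mul_nonneg (ind_nonneg a l) (ind_nonneg c l)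
theorem gh_nonneg (a c : Finset (Fin n)) (l) : 0 ≤ gh a c l :=
  mul_nonneg (ind_nonneg c l) (by linarith [ind_le_one a l])
theorem ca_nonneg (a c : Finset (Fin n)) (l) : 0 ≤ ca a c l :=
  mul_nonneg (ind_nonneg a l) (by linarith [ind_le_one c l])
theorem lt_nonneg (c : Finset (Fin n)) (l) : 0 ≤ lt c l := by unfold lt; linarith [ind_le_one c l]
theorem gh_le_one (a c : Finset (Fin n)) (l) : gh a c l ≤ 1 := by
  unfold gh
  have := ind_nonneg a l; have := ind_le_one a l; have := ind_nonneg c l; have := ind_le_one c l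
  nlinarith
theorem offd_nonneg (l l' : Fin n) : 0 ≤ offd l l' := by unfold offd; split_ifs <;> norm_num

/-! ### Venn-cell expansion: every coordinate sum is a linear form in the 16 cell counts of `(a, c, b, P)` -/

def chi (x : ℤ) : Bool → ℤ
  | true => x
  | false => 1 - x
@[simp] theorem chi_true (x : ℤ) : chi x true = x := rfl
@[simp] theorem chi_false (x : ℤ) : chi x false = 1 - x := rfl
def bi : Bool → ℤ
  | true => 1
  | false => 0
@[simp] theorem bi_true : bi true = 1 := rfl
@[simp] theorem bi_false : bi false = 0 := rfl

abbrev Cell := Bool × Bool × Bool × Bool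

def cellInd (a c b P : Finset (Fin n)) (l : Fin n) (e : Cell) : ℤ :=
  chi (ind a l) e.1 * chi (ind c l) e.2.1 * chi (ind b l) e.2.2.1 * chi (ind P l) e.2.2.2

/-- the 16 Venn-cell counts of `(a, c, b, P)` -/
def cellN (a c b P : Finset (Fin n)) (e : Cell) : ℤ := ∑ l, cellInd a c b P l e

theorem expand (p : ℤ → ℤ → ℤ → ℤ → ℤ) (a c b P : Finset (Fin n)) (l : Fin n) :
    p (ind a l) (ind c l) (ind b l) (ind P l) =
      ∑ e : Cell, p (bi e.1) (bi e.2.1) (bi e.2.2.1) (bi e.2.2.2) * cellInd a c b P l e := by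
  simp only [Fintype.sum_prod_type, Fintype.sum_bool, cellInd, bi_true, bi_false, chi_true, chi_false]
  rcases ind01 a l with h1 | h1 <;> rcases ind01 c l with h2 | h2 <;> rcases ind01 b l with h3 | h3 <;>
    rcases ind01 P l with h4 | h4 <;> simp only [h1, h2, h3, h4] <;> norm_num

theorem sum_expand (p : ℤ → ℤ → ℤ → ℤ → ℤ) (a c b P : Finset (Fin n)) :
    ∑ l, p (ind a l) (ind c l) (ind b l) (ind P l) =
      ∑ e : Cell, p (bi e.1) (bi e.2.1) (bi e.2.2.1) (bi e.2.2.2) * cellN a c b P e := by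
  simp_rw [expand p a c b P]
  rw [Finset.sum_comm]
  refine Finset.sum_congr rfl fun e _ => ?_
  rw [cellN, Finset.mul_sum]

/-! ### separation helpers for the pair families -/

theorem sum2_sep (κ : ℤ) (f g : Fin n → ℤ) (h : Fin n → Fin n → ℤ) (hh : ∀ l l', h l l' = κ * (f l * g l')) :
    ∑ l, ∑ l', h l l' = κ * ((∑ l, f l) * (∑ l, g l)) := by
  rw [Finset.sum_mul_sum, Finset.mul_sum]
  refine Finset.sum_congr rfl fun l _ => ?_
  rw [Finset.mul_sum]
  exact Finset.sum_congr rfl fun l' _ => hh l l'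

theorem sum2_offd (κ : ℤ) (f g : Fin n → ℤ) (h : Fin n → Fin n → ℤ)
    (hh : ∀ l l', h l l' = κ * (offd l l' * (f l * g l'))) :
    ∑ l, ∑ l', h l l' = κ * ((∑ l, f l) * (∑ l, g l) - ∑ l, f l * g l) := by
  have e1 : ∀ l l', h l l' = κ * (f l * g l') - (if l = l' then κ * (f l * g l') else 0) := by
    intro l l'; rw [hh]; unfold offd; split_ifs <;> ring
  have e2 : ∀ l, ∑ l', h l l' = κ * (f l * ∑ l', g l') - κ * (f l * g l) := by
    intro l
    rw [Finset.sum_congr rfl (fun l' _ => e1 l l'), Finset.sum_sub_distrib, Finset.sum_ite_eq]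
    simp only [Finset.mem_univ, if_true]
    rw [Finset.mul_sum, Finset.mul_sum]
  rw [Finset.sum_congr rfl (fun l _ => e2 l), Finset.sum_sub_distrib, ← Finset.mul_sum, ← Finset.mul_sum,
    Finset.sum_mul]
  ring

theorem sum2_add2 (h h₁ h₂ : Fin n → Fin n → ℤ) (hh : ∀ l l', h l l' = h₁ l l' + h₂ l l') :
    ∑ l, ∑ l', h l l' = (∑ l, ∑ l', h₁ l l') + ∑ l, ∑ l', h₂ l l' := by
  rw [← Finset.sum_add_distrib]
  refine Finset.sum_congr rfl fun l _ => ?_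
  rw [← Finset.sum_add_distrib]
  exact Finset.sum_congr rfl fun l' _ => hh l l'

theorem sum2_add3 (h h₁ h₂ h₃ : Fin n → Fin n → ℤ) (hh : ∀ l l', h l l' = h₁ l l' + h₂ l l' + h₃ l l') :
    ∑ l, ∑ l', h l l' = (∑ l, ∑ l', h₁ l l') + (∑ l, ∑ l', h₂ l l') + ∑ l, ∑ l', h₃ l l' := by
  rw [← Finset.sum_add_distrib, ← Finset.sum_add_distrib]
  refine Finset.sum_congr rfl fun l _ => ?_
  rw [← Finset.sum_add_distrib, ← Finset.sum_add_distrib]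
  exact Finset.sum_congr rfl fun l' _ => hh l l'

/-! ### the certificate -/

/-- index of the tilted certificate inside one class: a constant slot, 4 single families, 10 pair families -/
abbrev TIdx (n : ℕ) := Unit ⊕ (Fin 4 × Fin n) ⊕ (Fin 10 × (Fin n × Fin n))

/-- row factors of the pair families (pure products of type indicators) -/
def pairRow (a c : Finset (Fin n)) : Fin 10 → Fin n → Fin n → ℤ :=
  ![fun l l' => ca a c l * ca a c l', fun l l' => ca a c l * lv a c l', fun l l' => ind c l * lt c l',
    fun l l' => lv a c l * lv a c l', fun l l' => gh a c l * gh a c l', fun l l' => gh a c l * lv a c l',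
    fun l l' => lt c l * lt c l', fun l l' => lt c l * lv a c l', fun l l' => lt c l * (1 - gh a c l'),
    fun l l' => lt c l * gh a c l']

/-- row factors of the single families -/
def singRow (a c : Finset (Fin n)) : Fin 4 → Fin n → ℤ :=
  ![fun l => lt c l, fun l => ind c l, fun l => gh a c l, fun l => lv a c l]

/-- column factors of the pair families (generic in `P, κ, D`; the inversion indicator enters family 2 only) -/
def pairColG (lam κ : ℤ) (b P : Finset (Fin n)) (I : Fin n → Fin n → ℤ) : Fin 10 → Fin n → Fin n → ℤ :=
  ![fun l l' => offd l l' * (ind b l * ind b l'),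
    fun l l' => 2 * (ind b l * ind b l'),
    fun l l' => lam * (((1 - ind P l) * (1 - ind P l') + ind P l * ind P l') * I l l' +
      κ * ((1 - ind P l) * ((1 - ind b l') * ind P l'))),
    fun l l' => offd l l' * ((1 - κ) * (ind b l * ind b l')) +
      κ * ((ind b l * (1 - ind P l)) * (ind b l' * (1 - ind P l'))),
    fun l l' => κ * (((1 - ind b l) * ind P l) * ((1 - ind b l') * ind P l') + (1 - ind P l) * (1 - ind P l') +
      2 * (((1 - ind b l) * ind P l) * (1 - ind P l'))),
    fun l l' => κ * (2 * (((1 - ind b l) * ind P l) * (ind b l' * (1 - ind P l'))) +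
      2 * ((1 - ind P l) * (ind b l' * (1 - ind P l')))),
    fun l l' => offd l l' * ((1 - κ) * (lam * (ind P l * ind P l')) +
      κ * ((lam - 2) * ((ind b l * ind P l) * (ind b l' * ind P l')))) +
      κ * ((ind b l * ind P l) * ((ind b l' * ind P l') + (lam - 2) * ((1 - ind b l') * ind P l'))),
    fun l l' => κ * (2 * ((ind b l * ind P l) * ((1 - ind b l') * (1 - ind P l')))),
    fun l _ => κ * (2 * (ind b l * ind P l)),
    fun l l' => κ * (2 * ((ind b l * ind P l) * (ind b l' + (1 - ind b l') * (1 - ind P l'))))]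

/-- column factors of the single families (generic) -/
def singColG (lam κ D : ℤ) (nn : ℤ) (b P : Finset (Fin n)) : Fin 4 → Fin n → ℤ :=
  ![fun l => (1 - κ) * (ind b l * ind P l) + κ * ((lam - 2 - 2 * nn - 2 * D) * (ind b l * ind P l)),
    fun l => (1 - κ) * ((1 - ind P l) * (lam - ind b l)),
    fun l => κ * (2 * D * ((1 - ind b l) * ind P l) + 2 * D * (1 - ind P l) + (1 - ind b l) * ind P l +
      (1 - ind b l) * (1 - ind P l)),
    fun l => κ * (2 * D * (ind b l * (1 - ind P l)))]

/-- the constant slot (generic) -/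
def constColG (κ D : ℤ) : ℤ := (1 - κ) * (-D) + κ * D ^ 2

/-- the generic certificate value `Σ_s row_s · col_s` written out -/
def certG (lam κ D nn : ℤ) (a c b P : Finset (Fin n)) (I : Fin n → Fin n → ℤ) : ℤ :=
  constColG κ D + (∑ j : Fin 4, ∑ l, singRow a c j l * singColG lam κ D nn b P j l) +
    ∑ j : Fin 10, ∑ l, ∑ l', pairRow a c j l l' * pairColG lam κ b P I j l l'

/-- ★ THE CORE SET IDENTITY (generic located set `P` with `|P| = |c|`, `κ ∈ {0,1}`, `D = |b∩P| − |c∖a| − 1`):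
`(1−|a∩b|)² + |(a∖c)∩b| + |(c∖a)∖b| + λ·(|c∖P|·|P∖c| + E) = certG`, where `E` is the generic pair sum of family 2. -/
theorem tilt_core (lam κ D : ℤ) (a c b P : Finset (Fin n)) (I : Fin n → Fin n → ℤ) (hP : P.card = c.card)
    (hD : D = ((b ∩ P).card : ℤ) - ((c \ a).card : ℤ) - 1) (hκ : κ = 0 ∨ κ = 1) :
    (1 - ((a ∩ b).card : ℤ)) ^ 2 + (((a \ c) ∩ b).card : ℤ) + (((c \ a) \ b).card : ℤ) +
      lam * ((∑ l, ind c l * (1 - ind P l)) * (∑ l, lt c l * ind P l) +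
        ∑ l, ∑ l', ind c l * lt c l' * ((((1 - ind P l) * (1 - ind P l') + ind P l * ind P l') * I l l'))) =
      certG lam κ D (n : ℤ) a c b P I := by
  unfold certG
  simp only [Fin.sum_univ_succ, Fin.sum_univ_zero, pairRow, singRow, pairColG, singColG, constColG,
    Matrix.cons_val_zero, Matrix.cons_val_succ, add_zero]
  -- (1) cards to coordinate sums
  have c1 : ((a ∩ b).card : ℤ) = ∑ l, ind a l * ind b l := (sum_ind_mul a b).symm
  have c2 : (((a \ c) ∩ b).card : ℤ) = ∑ l, ca a c l * ind b l := by
    rw [← sum_ind_mul]; exact Finset.sum_congr rfl fun l _ => by rw [ind_sdiff]; rfl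
  have c3 : (((c \ a) \ b).card : ℤ) = ∑ l, gh a c l * (1 - ind b l) := by
    rw [← sum_ind]; exact Finset.sum_congr rfl fun l _ => by rw [ind_sdiff, ind_sdiff]; rfl
  have c4 : ((b ∩ P).card : ℤ) = ∑ l, ind b l * ind P l := (sum_ind_mul b P).symm
  have c5 : ((c \ a).card : ℤ) = ∑ l, gh a c l := by
    rw [← sum_ind]; exact Finset.sum_congr rfl fun l _ => by rw [ind_sdiff]; rfl
  have hR2 : ∑ l, ind c l = ∑ l, ind P l := by rw [sum_ind, sum_ind, hP]
  have hn : ((n : ℕ) : ℤ) = ∑ l : Fin n, (1 : ℤ) := by simp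
  rw [c1, c2, c3]
  rw [c4, c5] at hD
  -- (2) separate the pair families
  have hP0 : (∑ l, ∑ l', ca a c l * ca a c l' * (offd l l' * (ind b l * ind b l'))) =
      1 * ((∑ l, ca a c l * ind b l) * (∑ l, ca a c l * ind b l) - ∑ l, ca a c l * ind b l * (ca a c l * ind b l)) :=
    sum2_offd 1 (fun l => ca a c l * ind b l) (fun l => ca a c l * ind b l) _ (fun l l' => by ring)
  have hP1 : (∑ l, ∑ l', ca a c l * lv a c l' * (2 * (ind b l * ind b l'))) =
      2 * ((∑ l, ca a c l * ind b l) * (∑ l, lv a c l * ind b l)) :=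
    sum2_sep 2 (fun l => ca a c l * ind b l) (fun l => lv a c l * ind b l) _ (fun l l' => by ring)
  have hP2 : (∑ l, ∑ l', ind c l * lt c l' * (lam * (((1 - ind P l) * (1 - ind P l') + ind P l * ind P l') * I l l' +
      κ * ((1 - ind P l) * ((1 - ind b l') * ind P l'))))) =
      (∑ l, ∑ l', lam * (ind c l * lt c l' * ((((1 - ind P l) * (1 - ind P l') + ind P l * ind P l') * I l l')))) +
      ∑ l, ∑ l', (lam * κ) * ((ind c l * (1 - ind P l)) * (lt c l' * ((1 - ind b l') * ind P l'))) :=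
    sum2_add2 _ _ _ (fun l l' => by ring)
  have hP2a : (∑ l, ∑ l', lam * (ind c l * lt c l' * ((((1 - ind P l) * (1 - ind P l') + ind P l * ind P l') * I l l')))) =
      lam * ∑ l, ∑ l', ind c l * lt c l' * ((((1 - ind P l) * (1 - ind P l') + ind P l * ind P l') * I l l')) := by
    rw [Finset.mul_sum]; exact Finset.sum_congr rfl fun l _ => by rw [Finset.mul_sum]
  have hP2b : (∑ l, ∑ l', (lam * κ) * ((ind c l * (1 - ind P l)) * (lt c l' * ((1 - ind b l') * ind P l')))) =
      (lam * κ) * ((∑ l, ind c l * (1 - ind P l)) * (∑ l, lt c l * ((1 - ind b l) * ind P l))) :=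
    sum2_sep (lam * κ) (fun l => ind c l * (1 - ind P l)) (fun l => lt c l * ((1 - ind b l) * ind P l)) _ (fun l l' => by ring)
  have hP3 : (∑ l, ∑ l', lv a c l * lv a c l' * (offd l l' * ((1 - κ) * (ind b l * ind b l')) +
      κ * ((ind b l * (1 - ind P l)) * (ind b l' * (1 - ind P l'))))) =
      (∑ l, ∑ l', (1 - κ) * (offd l l' * ((lv a c l * ind b l) * (lv a c l' * ind b l')))) +
      ∑ l, ∑ l', κ * ((lv a c l * (ind b l * (1 - ind P l))) * (lv a c l' * (ind b l' * (1 - ind P l')))) :=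
    sum2_add2 _ _ _ (fun l l' => by ring)
  have hP3a : (∑ l, ∑ l', (1 - κ) * (offd l l' * ((lv a c l * ind b l) * (lv a c l' * ind b l')))) =
      (1 - κ) * ((∑ l, lv a c l * ind b l) * (∑ l, lv a c l * ind b l) - ∑ l, lv a c l * ind b l * (lv a c l * ind b l)) :=
    sum2_offd (1 - κ) (fun l => lv a c l * ind b l) (fun l => lv a c l * ind b l) _ (fun l l' => by ring)
  have hP3b : (∑ l, ∑ l', κ * ((lv a c l * (ind b l * (1 - ind P l))) * (lv a c l' * (ind b l' * (1 - ind P l'))))) =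
      κ * ((∑ l, lv a c l * (ind b l * (1 - ind P l))) * (∑ l, lv a c l * (ind b l * (1 - ind P l)))) :=
    sum2_sep κ (fun l => lv a c l * (ind b l * (1 - ind P l))) (fun l => lv a c l * (ind b l * (1 - ind P l))) _
      (fun l l' => by ring)
  have hP4 : (∑ l, ∑ l', gh a c l * gh a c l' * (κ * ((1 - ind b l) * ind P l * ((1 - ind b l') * ind P l') +
      (1 - ind P l) * (1 - ind P l') + 2 * ((1 - ind b l) * ind P l * (1 - ind P l'))))) =
      (∑ l, ∑ l', κ * ((gh a c l * ((1 - ind b l) * ind P l)) * (gh a c l' * ((1 - ind b l') * ind P l')))) +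
      (∑ l, ∑ l', κ * ((gh a c l * (1 - ind P l)) * (gh a c l' * (1 - ind P l')))) +
      ∑ l, ∑ l', (2 * κ) * ((gh a c l * ((1 - ind b l) * ind P l)) * (gh a c l' * (1 - ind P l'))) :=
    sum2_add3 _ _ _ _ (fun l l' => by ring)
  have hP4a : (∑ l, ∑ l', κ * ((gh a c l * ((1 - ind b l) * ind P l)) * (gh a c l' * ((1 - ind b l') * ind P l')))) =
      κ * ((∑ l, gh a c l * ((1 - ind b l) * ind P l)) * (∑ l, gh a c l * ((1 - ind b l) * ind P l))) :=
    sum2_sep κ _ _ _ (fun l l' => by ring)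
  have hP4b : (∑ l, ∑ l', κ * ((gh a c l * (1 - ind P l)) * (gh a c l' * (1 - ind P l')))) =
      κ * ((∑ l, gh a c l * (1 - ind P l)) * (∑ l, gh a c l * (1 - ind P l))) :=
    sum2_sep κ _ _ _ (fun l l' => by ring)
  have hP4c : (∑ l, ∑ l', (2 * κ) * ((gh a c l * ((1 - ind b l) * ind P l)) * (gh a c l' * (1 - ind P l')))) =
      (2 * κ) * ((∑ l, gh a c l * ((1 - ind b l) * ind P l)) * (∑ l, gh a c l * (1 - ind P l))) :=
    sum2_sep (2 * κ) _ _ _ (fun l l' => by ring)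
  have hP5 : (∑ l, ∑ l', gh a c l * lv a c l' * (κ * (2 * ((1 - ind b l) * ind P l * (ind b l' * (1 - ind P l'))) +
      2 * ((1 - ind P l) * (ind b l' * (1 - ind P l')))))) =
      (∑ l, ∑ l', (2 * κ) * ((gh a c l * ((1 - ind b l) * ind P l)) * (lv a c l' * (ind b l' * (1 - ind P l'))))) +
      ∑ l, ∑ l', (2 * κ) * ((gh a c l * (1 - ind P l)) * (lv a c l' * (ind b l' * (1 - ind P l')))) :=
    sum2_add2 _ _ _ (fun l l' => by ring)
  have hP5a : (∑ l, ∑ l', (2 * κ) * ((gh a c l * ((1 - ind b l) * ind P l)) * (lv a c l' * (ind b l' * (1 - ind P l'))))) =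
      (2 * κ) * ((∑ l, gh a c l * ((1 - ind b l) * ind P l)) * (∑ l, lv a c l * (ind b l * (1 - ind P l)))) :=
    sum2_sep (2 * κ) _ _ _ (fun l l' => by ring)
  have hP5b : (∑ l, ∑ l', (2 * κ) * ((gh a c l * (1 - ind P l)) * (lv a c l' * (ind b l' * (1 - ind P l'))))) =
      (2 * κ) * ((∑ l, gh a c l * (1 - ind P l)) * (∑ l, lv a c l * (ind b l * (1 - ind P l)))) :=
    sum2_sep (2 * κ) _ _ _ (fun l l' => by ring)
  have hP6 : (∑ l, ∑ l', lt c l * lt c l' * (offd l l' * ((1 - κ) * (lam * (ind P l * ind P l')) +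
      κ * ((lam - 2) * (ind b l * ind P l * (ind b l' * ind P l')))) +
      κ * (ind b l * ind P l * (ind b l' * ind P l' + (lam - 2) * ((1 - ind b l') * ind P l'))))) =
      (∑ l, ∑ l', ((1 - κ) * lam) * (offd l l' * ((lt c l * ind P l) * (lt c l' * ind P l')))) +
      (∑ l, ∑ l', (κ * (lam - 2)) * (offd l l' * ((lt c l * (ind b l * ind P l)) * (lt c l' * (ind b l' * ind P l'))))) +
      ∑ l, ∑ l', κ * ((lt c l * (ind b l * ind P l)) *
        (lt c l' * (ind b l' * ind P l' + (lam - 2) * ((1 - ind b l') * ind P l')))) :=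
    sum2_add3 _ _ _ _ (fun l l' => by ring)
  have hP6a : (∑ l, ∑ l', ((1 - κ) * lam) * (offd l l' * ((lt c l * ind P l) * (lt c l' * ind P l')))) =
      ((1 - κ) * lam) * ((∑ l, lt c l * ind P l) * (∑ l, lt c l * ind P l) - ∑ l, lt c l * ind P l * (lt c l * ind P l)) :=
    sum2_offd ((1 - κ) * lam) _ _ _ (fun l l' => by ring)
  have hP6b : (∑ l, ∑ l', (κ * (lam - 2)) * (offd l l' * ((lt c l * (ind b l * ind P l)) * (lt c l' * (ind b l' * ind P l'))))) =
      (κ * (lam - 2)) * ((∑ l, lt c l * (ind b l * ind P l)) * (∑ l, lt c l * (ind b l * ind P l)) -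
        ∑ l, lt c l * (ind b l * ind P l) * (lt c l * (ind b l * ind P l))) :=
    sum2_offd (κ * (lam - 2)) _ _ _ (fun l l' => by ring)
  have hP6c : (∑ l, ∑ l', κ * ((lt c l * (ind b l * ind P l)) *
        (lt c l' * (ind b l' * ind P l' + (lam - 2) * ((1 - ind b l') * ind P l'))))) =
      κ * ((∑ l, lt c l * (ind b l * ind P l)) * (∑ l, lt c l * (ind b l * ind P l + (lam - 2) * ((1 - ind b l) * ind P l)))) :=
    sum2_sep κ _ _ _ (fun l l' => by ring)
  have hP7 : (∑ l, ∑ l', lt c l * lv a c l' * (κ * (2 * (ind b l * ind P l * ((1 - ind b l') * (1 - ind P l')))))) =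
      (2 * κ) * ((∑ l, lt c l * (ind b l * ind P l)) * (∑ l, lv a c l * ((1 - ind b l) * (1 - ind P l)))) :=
    sum2_sep (2 * κ) _ _ _ (fun l l' => by ring)
  have hP8 : (∑ l, ∑ l', lt c l * (1 - gh a c l') * (κ * (2 * (ind b l * ind P l)))) =
      (2 * κ) * ((∑ l, lt c l * (ind b l * ind P l)) * (∑ l, (1 - gh a c l))) :=
    sum2_sep (2 * κ) _ _ _ (fun l l' => by ring)
  have hP9 : (∑ l, ∑ l', lt c l * gh a c l' * (κ * (2 * (ind b l * ind P l * (ind b l' + (1 - ind b l') * (1 - ind P l')))))) =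
      (2 * κ) * ((∑ l, lt c l * (ind b l * ind P l)) * (∑ l, gh a c l * (ind b l + (1 - ind b l) * (1 - ind P l)))) :=
    sum2_sep (2 * κ) _ _ _ (fun l l' => by ring)
  rw [hP0, hP1, hP2, hP2a, hP2b, hP3, hP3a, hP3b, hP4, hP4a, hP4b, hP4c, hP5, hP5a, hP5b, hP6, hP6a, hP6b, hP6c,
    hP7, hP8, hP9]
  -- (3) Venn-cell expansion of every coordinate sum
  have x1 : (∑ l, ca a c l * ind b l) = _ := sum_expand (fun A C B Q => A * (1 - C) * B) a c b P
  have x2 : (∑ l, ca a c l * ind b l * (ca a c l * ind b l)) = _ :=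
    sum_expand (fun A C B Q => A * (1 - C) * B * (A * (1 - C) * B)) a c b P
  have x3 : (∑ l, lv a c l * ind b l) = _ := sum_expand (fun A C B Q => A * C * B) a c b P
  have x4 : (∑ l, lv a c l * ind b l * (lv a c l * ind b l)) = _ :=
    sum_expand (fun A C B Q => A * C * B * (A * C * B)) a c b P
  have x5 : (∑ l, ind c l * (1 - ind P l)) = _ := sum_expand (fun A C B Q => C * (1 - Q)) a c b P
  have x6 : (∑ l, lt c l * ((1 - ind b l) * ind P l)) = _ := sum_expand (fun A C B Q => (1 - C) * ((1 - B) * Q)) a c b P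
  have x7 : (∑ l, lv a c l * (ind b l * (1 - ind P l))) = _ :=
    sum_expand (fun A C B Q => A * C * (B * (1 - Q))) a c b P
  have x8 : (∑ l, gh a c l * ((1 - ind b l) * ind P l)) = _ :=
    sum_expand (fun A C B Q => C * (1 - A) * ((1 - B) * Q)) a c b P
  have x9 : (∑ l, gh a c l * (1 - ind P l)) = _ := sum_expand (fun A C B Q => C * (1 - A) * (1 - Q)) a c b P
  have x10 : (∑ l, lt c l * ind P l) = _ := sum_expand (fun A C B Q => (1 - C) * Q) a c b P
  have x11 : (∑ l, lt c l * ind P l * (lt c l * ind P l)) = _ :=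
    sum_expand (fun A C B Q => (1 - C) * Q * ((1 - C) * Q)) a c b P
  have x12 : (∑ l, lt c l * (ind b l * ind P l)) = _ := sum_expand (fun A C B Q => (1 - C) * (B * Q)) a c b P
  have x13 : (∑ l, lt c l * (ind b l * ind P l) * (lt c l * (ind b l * ind P l))) = _ :=
    sum_expand (fun A C B Q => (1 - C) * (B * Q) * ((1 - C) * (B * Q))) a c b P
  have x14 : (∑ l, lt c l * (ind b l * ind P l + (lam - 2) * ((1 - ind b l) * ind P l))) = _ :=
    sum_expand (fun A C B Q => (1 - C) * (B * Q + (lam - 2) * ((1 - B) * Q))) a c b P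
  have x15 : (∑ l, lv a c l * ((1 - ind b l) * (1 - ind P l))) = _ :=
    sum_expand (fun A C B Q => A * C * ((1 - B) * (1 - Q))) a c b P
  have x16 : (∑ l, (1 - gh a c l)) = _ := sum_expand (fun A C B Q => 1 - C * (1 - A)) a c b P
  have x17 : (∑ l, gh a c l * (ind b l + (1 - ind b l) * (1 - ind P l))) = _ :=
    sum_expand (fun A C B Q => C * (1 - A) * (B + (1 - B) * (1 - Q))) a c b P
  have x18 : (∑ l, lt c l * ((1 - κ) * (ind b l * ind P l) + κ * ((lam - 2 - 2 * (n : ℤ) - 2 * D) * (ind b l * ind P l)))) = _ :=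
    sum_expand (fun A C B Q => (1 - C) * ((1 - κ) * (B * Q) + κ * ((lam - 2 - 2 * (n : ℤ) - 2 * D) * (B * Q)))) a c b P
  have x19 : (∑ l, ind c l * ((1 - κ) * ((1 - ind P l) * (lam - ind b l)))) = _ :=
    sum_expand (fun A C B Q => C * ((1 - κ) * ((1 - Q) * (lam - B)))) a c b P
  have x20 : (∑ l, gh a c l * (κ * (2 * D * ((1 - ind b l) * ind P l) + 2 * D * (1 - ind P l) + (1 - ind b l) * ind P l +
      (1 - ind b l) * (1 - ind P l)))) = _ :=
    sum_expand (fun A C B Q => C * (1 - A) * (κ * (2 * D * ((1 - B) * Q) + 2 * D * (1 - Q) + (1 - B) * Q +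
      (1 - B) * (1 - Q)))) a c b P
  have x21 : (∑ l, lv a c l * (κ * (2 * D * (ind b l * (1 - ind P l))))) = _ :=
    sum_expand (fun A C B Q => A * C * (κ * (2 * D * (B * (1 - Q))))) a c b P
  have x22 : (∑ l, ind a l * ind b l) = _ := sum_expand (fun A C B Q => A * B) a c b P
  have x23 : (∑ l, gh a c l * (1 - ind b l)) = _ := sum_expand (fun A C B Q => C * (1 - A) * (1 - B)) a c b P
  have x24 : (∑ l, ind b l * ind P l) = _ := sum_expand (fun A C B Q => B * Q) a c b P
  have x25 : (∑ l, gh a c l) = _ := sum_expand (fun A C B Q => C * (1 - A)) a c b P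
  have x26 : (∑ l, ind c l) = _ := sum_expand (fun A C B Q => C) a c b P
  have x27 : (∑ l, ind P l) = _ := sum_expand (fun A C B Q => Q) a c b P
  have x28 : (∑ l : Fin n, (1 : ℤ)) = _ := sum_expand (fun A C B Q => 1) a c b P
  rw [x1, x2, x3, x4, x5, x6, x7, x8, x9, x10, x11, x12, x13, x14, x15, x16, x17, x18, x19, x20, x21, x22, x23]
  rw [x24, x25] at hD
  rw [x26, x27] at hR2
  rw [x28] at hn
  rw [hn]
  simp only [Fintype.sum_prod_type, Fintype.sum_bool, bi_true, bi_false] at hD hR2 ⊢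
  subst hD
  rcases hκ with rfl | rfl
  · linear_combination (lam * (cellN a c b P (true, false, true, true) + cellN a c b P (true, false, false, true) +
      cellN a c b P (false, false, true, true) + cellN a c b P (false, false, false, true) - 1)) * hR2
  · linear_combination ((lam - 2) * (cellN a c b P (true, false, true, true) + cellN a c b P (false, false, true, true))) * hR2


/-! ### Lemma B — bubble-sort split of the inversion count at the located initial segment `P = P_k(π)` -/

/-- `inv(c;π) = |c∖P_k|·|P_k∖c| + E_k(c;π)`: every pair `(l ∈ c∖P_k, l′ ∈ P_k∖c)` is an inversion, no pair
`(l ∈ c∩P_k, l′ ∉ c ∪ P_k)` is, and `E_k` collects the inversions inside `P_k × P_k` and `P_kᶜ × P_kᶜ`. -/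
theorem inv_split (c : Finset (Fin n)) (π : Equiv.Perm (Fin n)) (k : ℕ) :
    inv c π = (∑ l, ind c l * (1 - ind (posLT π k) l)) * (∑ l, lt c l * ind (posLT π k) l) +
      ∑ l, ∑ l', ind c l * lt c l' * ((((1 - ind (posLT π k) l) * (1 - ind (posLT π k) l') +
        ind (posLT π k) l * ind (posLT π k) l') * invInd π l l')) := by
  unfold inv lt
  rw [Finset.sum_mul_sum, ← Finset.sum_add_distrib]
  refine Finset.sum_congr rfl fun l _ => ?_
  rw [← Finset.sum_add_distrib]
  refine Finset.sum_congr rfl fun l' _ => ?_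
  conv_lhs => rw [invInd_split π k l l']
  simp only [← ind_posLT]
  ring

/-- column data given the announced classes `(k, m) = (|c|, |c∖a|)`: `D = |b ∩ P_k(π)| − m − 1` and `κ = [D ≥ 0]` -/
def dee (b : Finset (Fin n)) (π : Equiv.Perm (Fin n)) (k m : ℕ) : ℤ := ((b ∩ posLT π k).card : ℤ) - m - 1
/-- `κ = [D ≥ 0]` -/
def kap (b : Finset (Fin n)) (π : Equiv.Perm (Fin n)) (k m : ℕ) : ℤ := if 0 ≤ dee b π k m then 1 else 0

theorem kap_dichotomy (b : Finset (Fin n)) (π : Equiv.Perm (Fin n)) (k m : ℕ) :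
    (kap b π k m = 1 ∧ 0 ≤ dee b π k m) ∨ (kap b π k m = 0 ∧ dee b π k m ≤ -1) := by
  unfold kap; split_ifs with h
  · exact Or.inl ⟨rfl, h⟩
  · exact Or.inr ⟨rfl, by omega⟩

theorem kap_cases (b : Finset (Fin n)) (π : Equiv.Perm (Fin n)) (k m : ℕ) : kap b π k m = 0 ∨ kap b π k m = 1 := by
  rcases kap_dichotomy b π k m with ⟨h, _⟩ | ⟨h, _⟩
  · exact Or.inr h
  · exact Or.inl h

theorem dee_le (b : Finset (Fin n)) (π : Equiv.Perm (Fin n)) (k m : ℕ) : dee b π k m ≤ (n : ℤ) - 1 := by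
  unfold dee
  have h1 : (b ∩ posLT π k).card ≤ n := by simpa using Finset.card_le_univ (b ∩ posLT π k)
  have h2 : ((b ∩ posLT π k).card : ℤ) ≤ n := by exact_mod_cast h1
  have h3 : (0 : ℤ) ≤ m := Nat.cast_nonneg m
  linarith

/-- the tilted left-hand side `S(a,c;b,π) = (1−|a∩b|)² + |(a∖c)∩b| + |(c∖a)∖b| + λ·inv(c;π)` (an integer) -/
def tiltLHS (lam : ℤ) (a c b : Finset (Fin n)) (π : Equiv.Perm (Fin n)) : ℤ :=
  (1 - ((a ∩ b).card : ℤ)) ^ 2 + (((a \ c) ∩ b).card : ℤ) + (((c \ a) \ b).card : ℤ) + lam * inv c π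

/-- ★★★ **THE TILTED PERMUTAHEDRAL IDENTITY** (all `n`, all `λ`, every tilted row `(a, c)` and column `(b, π)`; sorry-free):
`S(a,c;b,π) = certG λ κ D n a c b P_{|c|}(π) [π(l′)<π(l)]` with `D = |b∩P_{|c|}| − |c∖a| − 1`, `κ = [D ≥ 0]`. -/
theorem tilt_identity (lam : ℤ) (a c b : Finset (Fin n)) (π : Equiv.Perm (Fin n)) :
    tiltLHS lam a c b π = certG lam (kap b π c.card (c \ a).card) (dee b π c.card (c \ a).card) (n : ℤ) a c b
      (posLT π c.card) (invInd π) := by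
  have hkn : c.card ≤ n := by simpa using Finset.card_le_univ c
  unfold tiltLHS
  rw [inv_split c π c.card]
  exact tilt_core lam _ _ a c b (posLT π c.card) (invInd π) (card_posLT π hkn) (by unfold dee; rfl)
    (kap_cases b π c.card (c \ a).card)

/-! ### packaging: `rank₊ S ≤ (n+1)²·(10n² + 4n + 1)` -/

/-- index of the packaged tilted certificate: announced classes `(k, m) = (|c|, |c∖a|) ∈ {0,…,n}²` times `TIdx n`;
`|TPIdx n| = (n+1)²(10n² + 4n + 1)`. -/
abbrev TPIdx (n : ℕ) := (Fin (n + 1) × Fin (n + 1)) × TIdx n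

theorem card_TPIdx (n : ℕ) : Fintype.card (TPIdx n) = (n + 1) ^ 2 * (10 * n ^ 2 + 4 * n + 1) := by
  simp [TPIdx, TIdx, Fintype.card_sum, Fintype.card_prod, Fintype.card_fin]; ring

/-- row factors of one tilted row `(a, c)` -/
def tRow (a c : Finset (Fin n)) : TIdx n → ℤ :=
  Sum.elim (fun _ => 1) (Sum.elim (fun jl => singRow a c jl.1 jl.2) (fun jll => pairRow a c jll.1 jll.2.1 jll.2.2))

/-- column factors of one column `(b, π)` at announced classes `(k, m)` -/
def tCol (lam : ℤ) (b : Finset (Fin n)) (π : Equiv.Perm (Fin n)) (k m : ℕ) : TIdx n → ℤ :=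
  Sum.elim (fun _ => constColG (kap b π k m) (dee b π k m))
    (Sum.elim (fun jl => singColG lam (kap b π k m) (dee b π k m) (n : ℤ) b (posLT π k) jl.1 jl.2)
      (fun jll => pairColG lam (kap b π k m) b (posLT π k) (invInd π) jll.1 jll.2.1 jll.2.2))

/-- the identity in packaged form for ONE row -/
theorem tilt_identity' (lam : ℤ) (a c b : Finset (Fin n)) (π : Equiv.Perm (Fin n)) :
    tiltLHS lam a c b π = ∑ s, tRow a c s * tCol lam b π c.card (c \ a).card s := by
  rw [tilt_identity lam a c b π]
  unfold certG tRow tCol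
  simp only [Fintype.sum_sum_type, Fintype.sum_prod_type, Sum.elim_inl, Sum.elim_inr, Fintype.sum_unique, one_mul]
  ring

theorem pairRow_nonneg (a c : Finset (Fin n)) (j : Fin 10) (l l' : Fin n) : 0 ≤ pairRow a c j l l' := by
  have h1 := ca_nonneg a c l; have h2 := ca_nonneg a c l'; have h3 := lv_nonneg a c l; have h4 := lv_nonneg a c l'
  have h5 := gh_nonneg a c l; have h6 := gh_nonneg a c l'; have h7 := lt_nonneg c l; have h8 := lt_nonneg c l'
  have h9 := gh_le_one a c l'; have h10 := ind_nonneg c l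
  fin_cases j <;> simp [pairRow]
  all_goals apply_rules [mul_nonneg]
  all_goals linarith

theorem singRow_nonneg (a c : Finset (Fin n)) (j : Fin 4) (l : Fin n) : 0 ≤ singRow a c j l := by
  have h3 := lv_nonneg a c l; have h5 := gh_nonneg a c l; have h7 := lt_nonneg c l; have h10 := ind_nonneg c l
  fin_cases j <;> simp [singRow] <;> linarith

theorem tRow_nonneg (a c : Finset (Fin n)) (s : TIdx n) : 0 ≤ tRow a c s := by
  rcases s with u | ⟨j, l⟩ | ⟨j, l, l'⟩
  · simp [tRow]
  · simpa [tRow] using singRow_nonneg a c j l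
  · simpa [tRow] using pairRow_nonneg a c j l l'

theorem constColG_nonneg {κ D : ℤ} (h : (κ = 1 ∧ 0 ≤ D) ∨ (κ = 0 ∧ D ≤ -1)) : 0 ≤ constColG κ D := by
  unfold constColG; rcases h with ⟨rfl, hd⟩ | ⟨rfl, hd⟩ <;> nlinarith

theorem singColG_nonneg {lam κ D nn : ℤ} (b P : Finset (Fin n)) (hlam : 4 * nn + 2 ≤ lam) (hn : 0 ≤ nn)
    (hD : D ≤ nn - 1) (h : (κ = 1 ∧ 0 ≤ D) ∨ (κ = 0 ∧ D ≤ -1)) : ∀ j l, 0 ≤ singColG lam κ D nn b P j l := by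
  have hB0 := ind_nonneg b; have hB1 := ind_le_one b; have hP0 := ind_nonneg P; have hP1 := ind_le_one P
  have hl0 : 0 ≤ lam := by linarith
  have hw : 0 ≤ lam - 2 - 2 * nn - 2 * D := by rcases h with ⟨_, hd⟩ | ⟨_, hd⟩ <;> linarith
  simp only [Fin.forall_fin_succ, IsEmpty.forall_iff, and_true, singColG, Matrix.cons_val_zero, Matrix.cons_val_succ]
  rcases h with ⟨rfl, hd⟩ | ⟨rfl, hd⟩ <;> refine ⟨fun l => ?_, fun l => ?_, fun l => ?_, fun l => ?_⟩
  all_goals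
    have hb0 := hB0 l; have hp0 := hP0 l
    have hb1 : 0 ≤ 1 - ind b l := by linarith [hB1 l]
    have hp1 : 0 ≤ 1 - ind P l := by linarith [hP1 l]
    have hv : 0 ≤ lam - ind b l := by linarith [hB1 l]
    try simp only [sub_self, zero_mul, zero_add, add_zero, sub_zero, one_mul]
    generalize 1 - ind b l = yb at hb1 ⊢
    generalize 1 - ind P l = yp at hp1 ⊢
    generalize lam - 2 - 2 * nn - 2 * D = w at hw ⊢
    generalize lam - ind b l = v at hv ⊢
    positivity

theorem pairColG_nonneg {lam κ : ℤ} (b P : Finset (Fin n)) (I : Fin n → Fin n → ℤ) (hI : ∀ l l', 0 ≤ I l l')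
    (hlam : 2 ≤ lam) (h : κ = 0 ∨ κ = 1) : ∀ j l l', 0 ≤ pairColG lam κ b P I j l l' := by
  have hB0 := ind_nonneg b; have hB1 := ind_le_one b; have hP0 := ind_nonneg P; have hP1 := ind_le_one P
  have hl0 : 0 ≤ lam := by linarith
  have hl2 : 0 ≤ lam - 2 := by linarith
  simp only [Fin.forall_fin_succ, IsEmpty.forall_iff, and_true, pairColG, Matrix.cons_val_zero, Matrix.cons_val_succ]
  rcases h with rfl | rfl <;>
    refine ⟨fun l l' => ?_, fun l l' => ?_, fun l l' => ?_, fun l l' => ?_, fun l l' => ?_, fun l l' => ?_,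
      fun l l' => ?_, fun l l' => ?_, fun l l' => ?_, fun l l' => ?_⟩
  all_goals
    have hb0 := hB0 l; have hp0 := hP0 l; have hb0' := hB0 l'; have hp0' := hP0 l'
    have hi := hI l l'; have ho := offd_nonneg l l'
    have hb1 : 0 ≤ 1 - ind b l := by linarith [hB1 l]
    have hp1 : 0 ≤ 1 - ind P l := by linarith [hP1 l]
    have hb1' : 0 ≤ 1 - ind b l' := by linarith [hB1 l']
    have hp1' : 0 ≤ 1 - ind P l' := by linarith [hP1 l']
    try simp only [sub_self, zero_mul, mul_zero, zero_add, add_zero, sub_zero, one_mul]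
    generalize 1 - ind b l = yb at hb1 ⊢
    generalize 1 - ind P l = yp at hp1 ⊢
    generalize 1 - ind b l' = yb' at hb1' ⊢
    generalize 1 - ind P l' = yp' at hp1' ⊢
    generalize lam - 2 = z at hl2 ⊢
    generalize offd l l' = o at ho ⊢
    generalize I l l' = i at hi ⊢
    positivity

theorem tCol_nonneg {lam : ℤ} (hlam : 4 * (n : ℤ) + 2 ≤ lam) (b : Finset (Fin n)) (π : Equiv.Perm (Fin n)) (k m : ℕ)
    (s : TIdx n) : 0 ≤ tCol lam b π k m s := by
  have hDn : dee b π k m ≤ (n : ℤ) - 1 := dee_le b π k m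
  have hn0 : (0 : ℤ) ≤ n := Nat.cast_nonneg n
  rcases s with u | ⟨j, l⟩ | ⟨j, l, l'⟩
  · simpa only [tCol, Sum.elim_inl] using constColG_nonneg (kap_dichotomy b π k m)
  · simpa only [tCol, Sum.elim_inr, Sum.elim_inl] using
      singColG_nonneg b (posLT π k) hlam hn0 hDn (kap_dichotomy b π k m) j l
  · simpa only [tCol, Sum.elim_inr] using
      pairColG_nonneg b (posLT π k) (invInd π) (invInd_nonneg π) (by linarith) (kap_cases b π k m) j l l'

/-- ★★★ **`rank₊ S ≤ (n+1)²(10n² + 4n + 1)` for every `n` and every integer `λ ≥ 4n + 2`**: nonnegative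
`U : Finset (Fin n) × Finset (Fin n) → TPIdx n → ℝ` (rows `(a, c)`), `V : Finset (Fin n) × Equiv.Perm (Fin n) → TPIdx n → ℝ`
(columns `(b, π)`) with `(1 − |a∩b|)² + |(a∖c)∩b| + |(c∖a)∖b| + λ·inv(c;π) = Σ_s U (a,c) s · V (b,π) s` for ALL `a, c, b, π` —
the `{0,1}`-tilted rows of the diagonal permutahedron passenger `Q^Π_λ` (critic N22 STEP 3) are BLIND with `O(n⁴)` slots. -/
theorem tiltInv_rankPlus_le (n : ℕ) (lam : ℤ) (hlam : 4 * (n : ℤ) + 2 ≤ lam) :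
    ∃ (U : Finset (Fin n) × Finset (Fin n) → TPIdx n → ℝ) (V : Finset (Fin n) × Equiv.Perm (Fin n) → TPIdx n → ℝ),
      (∀ ac s, 0 ≤ U ac s) ∧ (∀ bπ s, 0 ≤ V bπ s) ∧
      ∀ (a c b : Finset (Fin n)) (π : Equiv.Perm (Fin n)),
        ((1 : ℝ) - ((a ∩ b).card : ℝ)) ^ 2 + (((a \ c) ∩ b).card : ℝ) + (((c \ a) \ b).card : ℝ) +
          (lam : ℝ) * (inv c π : ℝ) = ∑ s, U (a, c) s * V (b, π) s := by
  classical
  refine ⟨fun ac s => if (s.1.1 : ℕ) = ac.2.card ∧ (s.1.2 : ℕ) = (ac.2 \ ac.1).card then (tRow ac.1 ac.2 s.2 : ℝ) else 0,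
    fun bπ s => (tCol lam bπ.1 bπ.2 (s.1.1 : ℕ) (s.1.2 : ℕ) s.2 : ℝ), ?_, ?_, ?_⟩
  · intro ac s
    dsimp only
    split_ifs
    · exact_mod_cast tRow_nonneg ac.1 ac.2 s.2
    · exact le_rfl
  · intro bπ s
    dsimp only
    exact_mod_cast tCol_nonneg hlam bπ.1 bπ.2 _ _ s.2
  · intro a c b π
    have hkn : c.card < n + 1 := by
      have : c.card ≤ n := by simpa using Finset.card_le_univ c
      omega
    have hmn : (c \ a).card < n + 1 := by
      have : (c \ a).card ≤ n := by simpa using Finset.card_le_univ (c \ a)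
      omega
    have h := congrArg (fun z : ℤ => (z : ℝ)) (tilt_identity' lam a c b π)
    simp only [tiltLHS, Int.cast_add, Int.cast_pow, Int.cast_sub, Int.cast_one, Int.cast_mul, Int.cast_natCast,
      Int.cast_sum] at h
    rw [h, Fintype.sum_prod_type]
    rw [Finset.sum_eq_single ((⟨c.card, hkn⟩, ⟨(c \ a).card, hmn⟩) : Fin (n + 1) × Fin (n + 1))]
    · simp
    · rintro ⟨k, m⟩ _ hk
      have : ¬ ((k : ℕ) = c.card ∧ (m : ℕ) = (c \ a).card) := by
        rintro ⟨e1, e2⟩; exact hk (Prod.ext (Fin.ext e1) (Fin.ext e2))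
      simp [this]
    · intro h; exact absurd (Finset.mem_univ _) h

end Tilt


/-! ## §4 (rev 4). The SMALL column classes are blind for EVERY `λ ≥ 1`

The relief `β = |a|` of §2 is consumed only in the column class `p = |P_{|a|}(π) ∩ b| ≥ 2` (§1 MECHANISM, the charge `(p−s)·t ≤ |a|`);
in the classes `p ∈ {0,1}` the two `β`-carrying families of `weak_identity` cancel.  Switching them off and lowering the boundary
family to `X_lX_{l₂}(λ − [l = l₂])` gives a nonnegative certificate of the CLASS-RESTRICTED matrix
`[|P_{|a|}(π) ∩ b| ≤ 1]·((1 − |a∩b|)² + λ·inv(a;π))` for every integer `λ ≥ 1` with the SAME slot type `PIdx n`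
(`(n+1)(4n²+4n+1)` slots).  So the untilted small-λ residue `λ ∈ {1,…,|a|}` of the §2 docstring lives entirely on the columns whose
located prefix meets `b` at least twice (memo `Cruxes/NNDivisionHard/SmallLambda39.md`). -/

section SmallClass
variable {n : ℕ}

/-- small column class indicator `[|P ∩ b| ≤ 1]` -/
def cSmall (b P : Finset (Fin n)) : ℤ := if (P ∩ b).card ≤ 1 then 1 else 0

theorem cSmall_nonneg (b P : Finset (Fin n)) : 0 ≤ cSmall b P := by
  unfold cSmall; split_ifs <;> norm_num

/-- column factors of the small-class weak certificate: `cSmall • weakCol` with the two `β`-carrying families (4th and 7th) off -/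
def smallWeakCol (b P : Finset (Fin n)) : WIdx n → ℤ
  | Sum.inl u => cSmall b P * weakCol b P (Sum.inl u)
  | Sum.inr (Sum.inl i) => cSmall b P * weakCol b P (Sum.inr (Sum.inl i))
  | Sum.inr (Sum.inr (Sum.inl im)) => cSmall b P * weakCol b P (Sum.inr (Sum.inr (Sum.inl im)))
  | Sum.inr (Sum.inr (Sum.inr (Sum.inl _))) => 0
  | Sum.inr (Sum.inr (Sum.inr (Sum.inr (Sum.inl i)))) => cSmall b P * weakCol b P (Sum.inr (Sum.inr (Sum.inr (Sum.inr (Sum.inl i)))))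
  | Sum.inr (Sum.inr (Sum.inr (Sum.inr (Sum.inr (Sum.inl i))))) =>
      cSmall b P * weakCol b P (Sum.inr (Sum.inr (Sum.inr (Sum.inr (Sum.inr (Sum.inl i))))))
  | Sum.inr (Sum.inr (Sum.inr (Sum.inr (Sum.inr (Sum.inr _))))) => 0

theorem smallWeakCol_nonneg (b P : Finset (Fin n)) (idx : WIdx n) : 0 ≤ smallWeakCol b P idx := by
  have hc := cSmall_nonneg b P
  rcases idx with u | i | im | im | i | i | i <;> simp only [smallWeakCol] <;>
    first | exact le_rfl | exact mul_nonneg hc (weakCol_nonneg b P _)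

/-- ★ the small-class weak identity: `[|P∩b| ≤ 1]·((1 − |a∩b|)² + |a∖P|) = Σ_idx weakRow 1 |a| a idx · smallWeakCol b P idx`
(unit relief on the missing side only; no relief at all on the extra side). -/
theorem smallWeak_identity (a b P : Finset (Fin n)) :
    cSmall b P * ((1 - ((a ∩ b).card : ℤ)) ^ 2 + ((a.card : ℤ) - ((a ∩ P).card : ℤ))) =
      ∑ idx : WIdx n, weakRow 1 (a.card : ℤ) a idx * smallWeakCol b P idx := by
  classical
  by_cases h : (P ∩ b).card ≤ 1
  · have hc : cSmall b P = 1 := by simp [cSmall, h]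
    have hc2 : cTwo b P = 0 := by simp [cTwo]; omega
    have hw := weak_identity 1 (a.card : ℤ) a b P
    rw [weakLHS, sum_WIdx] at hw
    rw [sum_WIdx]
    simp only [weakRow, weakCol, smallWeakCol, hc, hc2, one_mul, zero_mul, mul_zero, sub_zero, mul_one, sub_self,
      Finset.sum_const_zero, add_zero] at hw ⊢
    have hB4 : ∑ i, ∑ m, (1 - ind a i) * ind a m * ind P i = ((P.card : ℤ) - ((a ∩ P).card : ℤ)) * (a.card : ℤ) := by
      have e : ∀ i, ∑ m, (1 - ind a i) * ind a m * ind P i = ((1 - ind a i) * ind P i) * ∑ m, ind a m := by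
        intro i; rw [Finset.mul_sum]; exact Finset.sum_congr rfl fun m _ => by ring
      rw [Finset.sum_congr rfl (fun i _ => e i), ← Finset.sum_mul, sum_ind a]
      have : ∑ i, (1 - ind a i) * ind P i = (P.card : ℤ) - ((a ∩ P).card : ℤ) := by
        rw [← sum_ind P, ← sum_ind_mul a P, ← Finset.sum_sub_distrib]
        exact Finset.sum_congr rfl fun i _ => by ring
      rw [this]
    rw [hB4] at hw
    linarith
  · have hc : cSmall b P = 0 := by simp [cSmall, h]
    rw [sum_WIdx]
    simp only [weakRow, smallWeakCol, hc, zero_mul, mul_zero, Finset.sum_const_zero, add_zero]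

/-- row factors at size class `k` for the small classes: weak rows at `(1, |a|)`, recourse rows `λX_l(1−X_{l′})`, boundary rows
`X_lX_{l₂}(λ − [l = l₂])` — nonnegative as soon as `λ ≥ 1`. -/
def smallRow (lam : ℤ) (a : Finset (Fin n)) : WIdx n ⊕ (Fin n × Fin n) ⊕ (Fin n × Fin n) → ℤ
  | Sum.inl idx => weakRow 1 (a.card : ℤ) a idx
  | Sum.inr (Sum.inl (l, l')) => lam * (ind a l * (1 - ind a l'))
  | Sum.inr (Sum.inr (l, l₂)) => ind a l * ind a l₂ * (lam - (if l = l₂ then 1 else 0))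

/-- column factors at size class `k` for the small classes (everything carries the class indicator `[|P_k(π) ∩ b| ≤ 1]`) -/
def smallCol (b : Finset (Fin n)) (π : Equiv.Perm (Fin n)) (k : ℕ) : WIdx n ⊕ (Fin n × Fin n) ⊕ (Fin n × Fin n) → ℤ
  | Sum.inl idx => smallWeakCol b (posLT π k) idx
  | Sum.inr (Sum.inl (l, l')) =>
      cSmall b (posLT π k) * (((1 - pInd π k l) * (1 - pInd π k l') + pInd π k l * pInd π k l') * invInd π l l')
  | Sum.inr (Sum.inr (l, l₂)) => cSmall b (posLT π k) * ((1 - pInd π k l) * (1 - pInd π k l₂))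

theorem smallRow_nonneg {lam : ℤ} {a : Finset (Fin n)} (hlam : 1 ≤ lam) (s) : 0 ≤ smallRow lam a s := by
  have h0 := ind_nonneg a; have h1 := ind_le_one a
  rcases s with idx | ⟨l, l'⟩ | ⟨l, l₂⟩ <;> simp only [smallRow]
  · exact weakRow_nonneg le_rfl le_rfl idx
  · exact mul_nonneg (by linarith) (mul_nonneg (h0 l) (by linarith [h1 l']))
  · refine mul_nonneg (mul_nonneg (h0 l) (h0 l₂)) ?_
    split_ifs <;> linarith

theorem smallCol_nonneg (b : Finset (Fin n)) (π : Equiv.Perm (Fin n)) (k : ℕ) (s) : 0 ≤ smallCol b π k s := by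
  have h0 := pInd_nonneg π k; have h1 := pInd_le_one π k
  have hc := cSmall_nonneg b (posLT π k)
  rcases s with idx | ⟨l, l'⟩ | ⟨l, l₂⟩ <;> simp only [smallCol]
  · exact smallWeakCol_nonneg b _ idx
  · refine mul_nonneg hc (mul_nonneg ?_ (invInd_nonneg π l l'))
    nlinarith [h0 l, h1 l, h0 l', h1 l', mul_nonneg (h0 l) (h0 l'),
      mul_nonneg (by linarith [h1 l] : (0:ℤ) ≤ 1 - pInd π k l) (by linarith [h1 l'] : (0:ℤ) ≤ 1 - pInd π k l')]
  · exact mul_nonneg hc (mul_nonneg (by linarith [h1 l]) (by linarith [h1 l₂]))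

/-- ★★ **THE SMALL-CLASS PERMUTAHEDRAL IDENTITY** (all `n`, all `λ`, every row `a` and column `(b, π)`; sorry-free):
`[|P∩b| ≤ 1]·((1 − |a∩b|)² + λ·inv(a;π)) = Σ_WIdx weakRow 1 |a| a · smallWeakCol b P`   (`P = P_{|a|}(π)`, no extra-side relief)
` + [|P∩b| ≤ 1]·Σ_{l,l′} λ X_l(1−X_{l′}) · ([l,l′ ∉ P] + [l,l′ ∈ P])[π(l′)<π(l)]`   (inversions inside `Pᶜ×Pᶜ` and `P×P`)
` + [|P∩b| ≤ 1]·Σ_{l,l₂} X_l X_{l₂}(λ − [l=l₂]) · [l ∉ P][l₂ ∉ P]`   (`λd² − d`, paid by the `d²` boundary inversions as soon as `λ ≥ 1`). -/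
theorem smallInv_identity (lam : ℤ) (a b : Finset (Fin n)) (π : Equiv.Perm (Fin n)) :
    cSmall b (posLT π a.card) * ((1 - ((a ∩ b).card : ℤ)) ^ 2 + lam * inv a π) =
      (∑ idx : WIdx n, weakRow 1 (a.card : ℤ) a idx * smallWeakCol b (posLT π a.card) idx) +
      ((∑ l, ∑ l', (lam * (ind a l * (1 - ind a l'))) *
          (cSmall b (posLT π a.card) *
            ((((1 - pInd π a.card l) * (1 - pInd π a.card l') + pInd π a.card l * pInd π a.card l') * invInd π l l')))) +
       (∑ l, ∑ l₂, (ind a l * ind a l₂ * (lam - (if l = l₂ then 1 else 0))) *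
          (cSmall b (posLT π a.card) * ((1 - pInd π a.card l) * (1 - pInd π a.card l₂))))) := by
  classical
  rw [← smallWeak_identity]
  set P := posLT π a.card with hPdef
  set cS : ℤ := cSmall b P with hcS
  have hkn : a.card ≤ n := by simpa using Finset.card_le_univ a
  have hPk : (P.card : ℤ) = (a.card : ℤ) := by rw [hPdef]; exact_mod_cast card_posLT π hkn
  have hX2 := ind_mul_self a
  have hP2 := pInd_mul_self π a.card
  have hPi : ∀ l, ind P l = pInd π a.card l := fun l => by rw [hPdef]; exact ind_posLT π a.card l
  -- (1) the recourse splits along `P` (§3 `inv_split`, rewritten with `pInd`)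
  have hinv : inv a π = (∑ l, ind a l * (1 - pInd π a.card l)) * (∑ l, (1 - ind a l) * pInd π a.card l) +
      ∑ l, ∑ l', ind a l * (1 - ind a l') *
        (((1 - pInd π a.card l) * (1 - pInd π a.card l') + pInd π a.card l * pInd π a.card l') * invInd π l l') := by
    have h := inv_split a π a.card
    simp only [lt, ← hPdef, hPi] at h
    exact h
  -- (2) the boundary family is `cS·(λ x² − x)`, `x = Σ X_l (1 − Π_l)`
  have hbd : ∑ l, ∑ l₂, (ind a l * ind a l₂ * (lam - (if l = l₂ then 1 else 0))) *
        (cS * ((1 - pInd π a.card l) * (1 - pInd π a.card l₂))) =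
      cS * (lam * (∑ l, ind a l * (1 - pInd π a.card l)) ^ 2 - ∑ l, ind a l * (1 - pInd π a.card l)) := by
    have e : ∀ l l₂, (ind a l * ind a l₂ * (lam - (if l = l₂ then 1 else 0))) *
        (cS * ((1 - pInd π a.card l) * (1 - pInd π a.card l₂))) =
        cS * (lam * ((ind a l * (1 - pInd π a.card l)) * (ind a l₂ * (1 - pInd π a.card l₂)))) -
          cS * (if l = l₂ then (ind a l * (1 - pInd π a.card l)) * (ind a l₂ * (1 - pInd π a.card l₂)) else 0) := by
      intro l l₂; split_ifs <;> ring
    have idem : ∀ l, (ind a l * (1 - pInd π a.card l)) * (ind a l * (1 - pInd π a.card l)) = ind a l * (1 - pInd π a.card l) := by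
      intro l
      linear_combination ((1 - pInd π a.card l) * (1 - pInd π a.card l)) * hX2 l + ind a l * hP2 l
    have inner : ∀ l, ∑ l₂, (ind a l * ind a l₂ * (lam - (if l = l₂ then 1 else 0))) *
        (cS * ((1 - pInd π a.card l) * (1 - pInd π a.card l₂))) =
        cS * (lam * ((ind a l * (1 - pInd π a.card l)) * ∑ l₂, ind a l₂ * (1 - pInd π a.card l₂))) -
          cS * (ind a l * (1 - pInd π a.card l)) := by
      intro l
      rw [Finset.sum_congr rfl (fun l₂ _ => e l l₂), Finset.sum_sub_distrib, ← Finset.mul_sum, ← Finset.mul_sum,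
        ← Finset.mul_sum, ← Finset.mul_sum, Finset.sum_ite_eq]
      simp only [Finset.mem_univ, if_true]
      rw [idem l]
    rw [Finset.sum_congr rfl (fun l _ => inner l), Finset.sum_sub_distrib, ← Finset.mul_sum, ← Finset.mul_sum,
      ← Finset.mul_sum, ← Finset.sum_mul, sq]
    ring
  have hE : ∑ l, ∑ l', (lam * (ind a l * (1 - ind a l'))) *
        (cS * ((((1 - pInd π a.card l) * (1 - pInd π a.card l') + pInd π a.card l * pInd π a.card l') * invInd π l l'))) =
      cS * (lam * ∑ l, ∑ l', ind a l * (1 - ind a l') *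
        (((1 - pInd π a.card l) * (1 - pInd π a.card l') + pInd π a.card l * pInd π a.card l') * invInd π l l')) := by
    rw [Finset.mul_sum, Finset.mul_sum]
    refine Finset.sum_congr rfl fun l _ => ?_
    rw [Finset.mul_sum, Finset.mul_sum]
    exact Finset.sum_congr rfl fun l' _ => by ring
  rw [hinv, hbd, hE]
  -- (3) bookkeeping: x = k − |a∩P| = y
  have sX := sum_ind a
  have sXP : ∑ l, ind a l * pInd π a.card l = ((a ∩ P).card : ℤ) := by
    simp_rw [← hPi]; exact sum_ind_mul a _
  have sP : ∑ l, pInd π a.card l = (P.card : ℤ) := by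
    simp_rw [← hPi]; exact sum_ind _
  have hx : ∑ l, ind a l * (1 - pInd π a.card l) = (a.card : ℤ) - ((a ∩ P).card : ℤ) := by
    rw [← sX, ← sXP, ← Finset.sum_sub_distrib]
    exact Finset.sum_congr rfl fun l _ => by ring
  have hy : ∑ l', (1 - ind a l') * pInd π a.card l' = (P.card : ℤ) - ((a ∩ P).card : ℤ) := by
    rw [← sP, ← sXP, ← Finset.sum_sub_distrib]
    exact Finset.sum_congr rfl fun l _ => by ring
  rw [hx, hy, hPk]
  ring

/-- the identity in packaged form for ONE row -/
theorem smallInv_identity' (lam : ℤ) (a b : Finset (Fin n)) (π : Equiv.Perm (Fin n)) :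
    cSmall b (posLT π a.card) * ((1 - ((a ∩ b).card : ℤ)) ^ 2 + lam * inv a π) =
      ∑ s, smallRow lam a s * smallCol b π a.card s := by
  rw [smallInv_identity lam a b π]
  simp only [Fintype.sum_sum_type, Fintype.sum_prod_type, smallRow, smallCol]

/-- ★★ **`rank₊([|P_{|a|}(π) ∩ b| ≤ 1]·((1 − |a∩b|)² + λ·inv(a;π))) ≤ (n+1)(4n² + 4n + 1)` for every `n` and every integer `λ ≥ 1`**:
nonnegative `U : Finset (Fin n) → PIdx n → ℝ`, `V : Finset (Fin n) × Equiv.Perm (Fin n) → PIdx n → ℝ` with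
`[|P_{|a|}(π) ∩ b| ≤ 1]·((1 − |a∩b|)² + λ·inv(a;π)) = Σ_s U a s · V (b,π) s` for ALL rows `a ⊆ [n]` and columns `(b, π)` — the columns whose
located prefix meets `b` at most once carry no lower bound for ANY `λ ≥ 1`; the small-λ residue is the class `|P_{|a|}(π) ∩ b| ≥ 2`. -/
theorem smallInv_rankPlus_le (n : ℕ) (lam : ℤ) (hlam : 1 ≤ lam) :
    ∃ (U : Finset (Fin n) → PIdx n → ℝ) (V : Finset (Fin n) × Equiv.Perm (Fin n) → PIdx n → ℝ),
      (∀ a s, 0 ≤ U a s) ∧ (∀ bπ s, 0 ≤ V bπ s) ∧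
      ∀ (a b : Finset (Fin n)) (π : Equiv.Perm (Fin n)),
        (cSmall b (posLT π a.card) : ℝ) * (((1 : ℝ) - ((a ∩ b).card : ℝ)) ^ 2 + (lam : ℝ) * (inv a π : ℝ)) =
          ∑ s, U a s * V (b, π) s := by
  classical
  refine ⟨fun a s => if (s.1 : ℕ) = a.card then (smallRow lam a s.2 : ℝ) else 0,
    fun bπ s => (smallCol bπ.1 bπ.2 (s.1 : ℕ) s.2 : ℝ), ?_, ?_, ?_⟩
  · intro a s
    dsimp only
    split_ifs
    · exact_mod_cast smallRow_nonneg hlam s.2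
    · exact le_rfl
  · intro bπ s
    dsimp only
    exact_mod_cast smallCol_nonneg bπ.1 bπ.2 _ s.2
  · intro a b π
    have hkn : a.card < n + 1 := by
      have : a.card ≤ n := by simpa using Finset.card_le_univ a
      omega
    have h := congrArg (fun z : ℤ => (z : ℝ)) (smallInv_identity' lam a b π)
    simp only [Int.cast_add, Int.cast_pow, Int.cast_sub, Int.cast_one, Int.cast_mul, Int.cast_natCast, Int.cast_sum] at h
    rw [h, Fintype.sum_prod_type]
    rw [Finset.sum_eq_single (⟨a.card, hkn⟩ : Fin (n + 1))]
    · simp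
    · intro k _ hk
      have : (k : ℕ) ≠ a.card := fun e => hk (Fin.ext e)
      simp [this]
    · intro h; exact absurd (Finset.mem_univ _) h

end SmallClass


/-! ## §5 The large column classes `|P ∩ b| ≥ 2` — and the full untilted theorem for every `λ ≥ 1` (rev 6)

For `|a| = |P|` and a column `b` meeting `P` in `q = |P ∩ b| ≥ 2` points, the unit weak relief `(1 − |a∩b|)² + |a∖P|` has the
explicit six-family certificate (`s = |a∩P∩b|`, `u = |(P∖a)∩b|`, `v = |(a∖P)∩b|`, `d = |a∖P| = |P∖a|`, `q = s + u`)
`2q(q−1)·((1−|a∩b|)² + |a∖P|) = q(q−1) + u(u−1) + 2(q−1)[(d−v)u + s(d−u)] + 2q(q−1)v(v−1) + 2(q−1)(2q−1)vs + (2(q−1)²−1)s(s−1)`,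
every term an ordered-pair family (row factor `(1−X_l)(1−X_{l′})`, `X_l(1−X_{l′})` or `X_lX_{l′}` ≥ 0; column factor a product of
`P`/`b` indicators with a coefficient that is ≥ 0 once `q ≥ 2`).  With §4 (`q ≤ 1`) and the bubble-sort split of §3 this gives
`inv_rankPlus_le`: `(1 − |a∩b|)² + λ·inv(a;π)` is blind for EVERY integer `λ ≥ 1`, on all rows and all columns, untilted. -/

section BigClass
variable {n : ℕ}

abbrev Cell3 := Bool × Bool × Bool

/-- Venn-cell indicator of `(a, b, P)` at coordinate `l` -/
def cellInd3 (a b P : Finset (Fin n)) (l : Fin n) (e : Cell3) : ℤ :=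
  chi (ind a l) e.1 * chi (ind b l) e.2.1 * chi (ind P l) e.2.2

/-- the 8 Venn-cell counts of `(a, b, P)` -/
def cellN3 (a b P : Finset (Fin n)) (e : Cell3) : ℤ := ∑ l, cellInd3 a b P l e

theorem expand3 (p : ℤ → ℤ → ℤ → ℤ) (a b P : Finset (Fin n)) (l : Fin n) :
    p (ind a l) (ind b l) (ind P l) = ∑ e : Cell3, p (bi e.1) (bi e.2.1) (bi e.2.2) * cellInd3 a b P l e := by
  simp only [Fintype.sum_prod_type, Fintype.sum_bool, cellInd3, bi_true, bi_false, chi_true, chi_false]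
  rcases ind01 a l with h1 | h1 <;> rcases ind01 b l with h3 | h3 <;>
    rcases ind01 P l with h4 | h4 <;> simp only [h1, h3, h4] <;> norm_num

theorem sum_expand3 (p : ℤ → ℤ → ℤ → ℤ) (a b P : Finset (Fin n)) :
    ∑ l, p (ind a l) (ind b l) (ind P l) = ∑ e : Cell3, p (bi e.1) (bi e.2.1) (bi e.2.2) * cellN3 a b P e := by
  simp_rw [expand3 p a b P]
  rw [Finset.sum_comm]
  refine Finset.sum_congr rfl fun e _ => ?_
  rw [cellN3, Finset.mul_sum]

/-- row factors of the six pair families of the large-class certificate (pure indicator products, ≥ 0) -/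
def bigRow (a : Finset (Fin n)) : Fin 6 → Fin n → Fin n → ℤ :=
  ![fun l l' => (1 - ind a l) * (1 - ind a l'), fun l l' => ind a l * (1 - ind a l'), fun l l' => ind a l * (1 - ind a l'),
    fun l l' => ind a l * ind a l', fun l l' => ind a l * ind a l', fun l l' => ind a l * ind a l']

/-- integer column factors of the six pair families (`q = |P ∩ b|`; every coefficient is ≥ 0 once `q ≥ 2`) -/
def bigCol (q : ℤ) (b P : Finset (Fin n)) : Fin 6 → Fin n → Fin n → ℤ :=
  ![fun l l' => offd l l' * ((ind P l * ind b l) * (ind P l' * ind b l')),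
    fun l l' => 2 * (q - 1) * (((1 - ind P l) * (1 - ind b l)) * (ind P l' * ind b l')),
    fun l l' => 2 * (q - 1) * ((ind P l * ind b l) * (ind P l' * (1 - ind b l'))),
    fun l l' => offd l l' * ((2 * q * (q - 1)) * (((1 - ind P l) * ind b l) * ((1 - ind P l') * ind b l'))),
    fun l l' => 2 * (q - 1) * (2 * q - 1) * (((1 - ind P l) * ind b l) * (ind P l' * ind b l')),
    fun l l' => offd l l' * ((2 * (q - 1) ^ 2 - 1) * ((ind P l * ind b l) * (ind P l' * ind b l')))]

/-- the integer certificate value: constant slot `q(q−1)` plus the six pair families -/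
def bigCert (q : ℤ) (a b P : Finset (Fin n)) : ℤ :=
  q * (q - 1) + ∑ j : Fin 6, ∑ l, ∑ l', bigRow a j l l' * bigCol q b P j l l'

/-- ★ THE LARGE-CLASS SET IDENTITY (any sets `a, b, P ⊆ [n]` with `|P| = |a|`, any `q`; used at `q = |P ∩ b|`):
`2q(q−1)·((1 − |a∩b|)² + (|a| − |a∩P|)) = bigCert q a b P`. -/
theorem big_core (q : ℤ) (a b P : Finset (Fin n)) (hP : P.card = a.card) (hq : q = ((P ∩ b).card : ℤ)) :
    2 * q * (q - 1) * ((1 - ((a ∩ b).card : ℤ)) ^ 2 + ((a.card : ℤ) - ((a ∩ P).card : ℤ))) = bigCert q a b P := by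
  unfold bigCert
  simp only [Fin.sum_univ_succ, Fin.sum_univ_zero, bigRow, bigCol, Matrix.cons_val_zero, Matrix.cons_val_succ, add_zero]
  have c1 : ((a ∩ b).card : ℤ) = ∑ l, ind a l * ind b l := (sum_ind_mul a b).symm
  have c2 : (a.card : ℤ) = ∑ l, ind a l := (sum_ind a).symm
  have c3 : ((a ∩ P).card : ℤ) = ∑ l, ind a l * ind P l := (sum_ind_mul a P).symm
  have c4 : ((P ∩ b).card : ℤ) = ∑ l, ind P l * ind b l := (sum_ind_mul P b).symm
  have hR2 : ∑ l, ind a l = ∑ l, ind P l := by rw [sum_ind, sum_ind, hP]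
  rw [c1, c2, c3]
  rw [c4] at hq
  -- (1) separate the six pair families
  have hP0 : (∑ l, ∑ l', (1 - ind a l) * (1 - ind a l') * (offd l l' * ((ind P l * ind b l) * (ind P l' * ind b l')))) =
      1 * ((∑ l, (1 - ind a l) * (ind P l * ind b l)) * (∑ l, (1 - ind a l) * (ind P l * ind b l)) -
        ∑ l, (1 - ind a l) * (ind P l * ind b l) * ((1 - ind a l) * (ind P l * ind b l))) :=
    sum2_offd 1 _ _ _ (fun l l' => by ring)
  have hP1 : (∑ l, ∑ l', ind a l * (1 - ind a l') * (2 * (q - 1) * (((1 - ind P l) * (1 - ind b l)) * (ind P l' * ind b l')))) =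
      (2 * (q - 1)) * ((∑ l, ind a l * ((1 - ind P l) * (1 - ind b l))) * (∑ l, (1 - ind a l) * (ind P l * ind b l))) :=
    sum2_sep _ _ _ _ (fun l l' => by ring)
  have hP2 : (∑ l, ∑ l', ind a l * (1 - ind a l') * (2 * (q - 1) * ((ind P l * ind b l) * (ind P l' * (1 - ind b l'))))) =
      (2 * (q - 1)) * ((∑ l, ind a l * (ind P l * ind b l)) * (∑ l, (1 - ind a l) * (ind P l * (1 - ind b l)))) :=
    sum2_sep _ _ _ _ (fun l l' => by ring)
  have hP3 : (∑ l, ∑ l', ind a l * ind a l' *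
      (offd l l' * ((2 * q * (q - 1)) * (((1 - ind P l) * ind b l) * ((1 - ind P l') * ind b l'))))) =
      (2 * q * (q - 1)) * ((∑ l, ind a l * ((1 - ind P l) * ind b l)) * (∑ l, ind a l * ((1 - ind P l) * ind b l)) -
        ∑ l, ind a l * ((1 - ind P l) * ind b l) * (ind a l * ((1 - ind P l) * ind b l))) :=
    sum2_offd _ _ _ _ (fun l l' => by ring)
  have hP4 : (∑ l, ∑ l', ind a l * ind a l' * (2 * (q - 1) * (2 * q - 1) * (((1 - ind P l) * ind b l) * (ind P l' * ind b l')))) =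
      (2 * (q - 1) * (2 * q - 1)) * ((∑ l, ind a l * ((1 - ind P l) * ind b l)) * (∑ l, ind a l * (ind P l * ind b l))) :=
    sum2_sep _ _ _ _ (fun l l' => by ring)
  have hP5 : (∑ l, ∑ l', ind a l * ind a l' *
      (offd l l' * ((2 * (q - 1) ^ 2 - 1) * ((ind P l * ind b l) * (ind P l' * ind b l'))))) =
      (2 * (q - 1) ^ 2 - 1) * ((∑ l, ind a l * (ind P l * ind b l)) * (∑ l, ind a l * (ind P l * ind b l)) -
        ∑ l, ind a l * (ind P l * ind b l) * (ind a l * (ind P l * ind b l))) :=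
    sum2_offd _ _ _ _ (fun l l' => by ring)
  rw [hP0, hP1, hP2, hP3, hP4, hP5]
  -- (2) Venn-cell expansion of every coordinate sum
  have x1 : (∑ l, ind a l * ind b l) = _ := sum_expand3 (fun A B Q => A * B) a b P
  have x2 : (∑ l, ind a l) = _ := sum_expand3 (fun A B Q => A) a b P
  have x3 : (∑ l, ind a l * ind P l) = _ := sum_expand3 (fun A B Q => A * Q) a b P
  have x4 : (∑ l, ind P l * ind b l) = _ := sum_expand3 (fun A B Q => Q * B) a b P
  have x5 : (∑ l, (1 - ind a l) * (ind P l * ind b l)) = _ := sum_expand3 (fun A B Q => (1 - A) * (Q * B)) a b P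
  have x6 : (∑ l, (1 - ind a l) * (ind P l * ind b l) * ((1 - ind a l) * (ind P l * ind b l))) = _ :=
    sum_expand3 (fun A B Q => (1 - A) * (Q * B) * ((1 - A) * (Q * B))) a b P
  have x7 : (∑ l, ind a l * ((1 - ind P l) * (1 - ind b l))) = _ :=
    sum_expand3 (fun A B Q => A * ((1 - Q) * (1 - B))) a b P
  have x8 : (∑ l, ind a l * (ind P l * ind b l)) = _ := sum_expand3 (fun A B Q => A * (Q * B)) a b P
  have x9 : (∑ l, (1 - ind a l) * (ind P l * (1 - ind b l))) = _ :=
    sum_expand3 (fun A B Q => (1 - A) * (Q * (1 - B))) a b P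
  have x10 : (∑ l, ind a l * ((1 - ind P l) * ind b l)) = _ := sum_expand3 (fun A B Q => A * ((1 - Q) * B)) a b P
  have x11 : (∑ l, ind a l * ((1 - ind P l) * ind b l) * (ind a l * ((1 - ind P l) * ind b l))) = _ :=
    sum_expand3 (fun A B Q => A * ((1 - Q) * B) * (A * ((1 - Q) * B))) a b P
  have x12 : (∑ l, ind a l * (ind P l * ind b l) * (ind a l * (ind P l * ind b l))) = _ :=
    sum_expand3 (fun A B Q => A * (Q * B) * (A * (Q * B))) a b P
  have x13 : (∑ l, ind P l) = _ := sum_expand3 (fun A B Q => Q) a b P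
  rw [x1, x2, x3, x5, x6, x7, x8, x9, x10, x11, x12]
  rw [x4] at hq
  rw [x2, x13] at hR2
  simp only [Fintype.sum_prod_type, Fintype.sum_bool, bi_true, bi_false] at hq hR2 ⊢
  subst hq
  linear_combination (2 * cellN3 a b P (true, true, true) *
    (cellN3 a b P (false, true, true) + cellN3 a b P (true, true, true) - 1)) * hR2

/-- the weighted, distributed form of `big_core` (any scalar `w`; used at `w = [|P∩b| ≥ 2]`) -/
theorem big_core_w (w q : ℤ) (a b P : Finset (Fin n)) (hP : P.card = a.card) (hq : q = ((P ∩ b).card : ℤ)) :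
    w * (2 * q * (q - 1)) * ((1 - ((a ∩ b).card : ℤ)) ^ 2 + ((a.card : ℤ) - ((a ∩ P).card : ℤ))) =
      w * (q * (q - 1)) + ∑ j : Fin 6, ∑ l, ∑ l', bigRow a j l l' * (w * bigCol q b P j l l') := by
  have h0 := big_core q a b P hP hq
  have e1 : w * (2 * q * (q - 1)) * ((1 - ((a ∩ b).card : ℤ)) ^ 2 + ((a.card : ℤ) - ((a ∩ P).card : ℤ))) =
      w * bigCert q a b P := by rw [← h0]; ring
  rw [e1, bigCert, mul_add, Finset.mul_sum]
  congr 1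
  refine Finset.sum_congr rfl fun j _ => ?_
  rw [Finset.mul_sum]
  refine Finset.sum_congr rfl fun l _ => ?_
  rw [Finset.mul_sum]
  exact Finset.sum_congr rfl fun l' _ => by ring

theorem cTwo_nonneg' (b P : Finset (Fin n)) : 0 ≤ cTwo b P := by
  unfold cTwo; split_ifs <;> norm_num

theorem two_le_of_cTwo (b P : Finset (Fin n)) (h : cTwo b P = 1) : (2 : ℤ) ≤ ((P ∩ b).card : ℤ) := by
  unfold cTwo at h
  split_ifs at h with h2
  · exact_mod_cast h2
  · norm_num at h

theorem cSmall_add_cTwo (b P : Finset (Fin n)) : cSmall b P + cTwo b P = 1 := by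
  unfold cSmall cTwo
  split_ifs <;> first | rfl | omega

theorem bigRow_nonneg (a : Finset (Fin n)) (j : Fin 6) (l l' : Fin n) : 0 ≤ bigRow a j l l' := by
  have h0 := ind_nonneg a; have h1 := ind_le_one a
  have g0 : ∀ i, (0 : ℤ) ≤ 1 - ind a i := fun i => by linarith [h1 i]
  fin_cases j <;> simp [bigRow] <;> apply_rules [mul_nonneg]

theorem bigCol_w_nonneg (b P : Finset (Fin n)) (j : Fin 6) (l l' : Fin n) :
    0 ≤ cTwo b P * bigCol ((P ∩ b).card : ℤ) b P j l l' := by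
  rcases cTwo_cases b P with h | h
  · rw [h, zero_mul]
  · have hq := two_le_of_cTwo b P h
    rw [h, one_mul]
    set q : ℤ := ((P ∩ b).card : ℤ)
    have hY := ind_nonneg b; have hY1 := ind_le_one b; have hQ := ind_nonneg P; have hQ1 := ind_le_one P
    have gY : ∀ i, (0 : ℤ) ≤ 1 - ind b i := fun i => by linarith [hY1 i]
    have gQ : ∀ i, (0 : ℤ) ≤ 1 - ind P i := fun i => by linarith [hQ1 i]
    have k1 : (0 : ℤ) ≤ 2 * (q - 1) := by linarith
    have k2 : (0 : ℤ) ≤ 2 * q * (q - 1) := mul_nonneg (by linarith) (by linarith)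
    have k3 : (0 : ℤ) ≤ 2 * (q - 1) * (2 * q - 1) := mul_nonneg k1 (by linarith)
    have k4 : (0 : ℤ) ≤ 2 * (q - 1) ^ 2 - 1 := by nlinarith
    have ko := offd_nonneg l l'
    fin_cases j <;> simp only [bigCol] <;> apply_rules [mul_nonneg]

/-! ### the large-class permutahedral identity and its packaging -/

/-- index of the large-class certificate inside one size class: constant, 6 pair families, recourse `E`, boundary -/
abbrev BIdx (n : ℕ) := Unit ⊕ (Fin 6 × (Fin n × Fin n)) ⊕ (Fin n × Fin n) ⊕ (Fin n × Fin n)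

/-- row factors (≥ 0 for `λ ≥ 1`) -/
def bigRowI (lam : ℤ) (a : Finset (Fin n)) : BIdx n → ℤ
  | Sum.inl _ => 1
  | Sum.inr (Sum.inl (j, (l, l'))) => bigRow a j l l'
  | Sum.inr (Sum.inr (Sum.inl (l, l'))) => lam * (ind a l * (1 - ind a l'))
  | Sum.inr (Sum.inr (Sum.inr (l, l₂))) => ind a l * ind a l₂ * (lam - (if l = l₂ then 1 else 0))

/-- integer column factors at size class `k` (`P = P_k(π)`, `q = |P ∩ b|`, everything carries `[q ≥ 2]`; ≥ 0) -/
def bigColI (b : Finset (Fin n)) (π : Equiv.Perm (Fin n)) (k : ℕ) : BIdx n → ℤ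
  | Sum.inl _ => cTwo b (posLT π k) * ((((posLT π k ∩ b).card : ℤ)) * ((((posLT π k ∩ b).card : ℤ)) - 1))
  | Sum.inr (Sum.inl (j, (l, l'))) => cTwo b (posLT π k) * bigCol (((posLT π k ∩ b).card : ℤ)) b (posLT π k) j l l'
  | Sum.inr (Sum.inr (Sum.inl (l, l'))) =>
      cTwo b (posLT π k) * (2 * (((posLT π k ∩ b).card : ℤ)) * ((((posLT π k ∩ b).card : ℤ)) - 1)) *
        (((1 - pInd π k l) * (1 - pInd π k l') + pInd π k l * pInd π k l') * invInd π l l')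
  | Sum.inr (Sum.inr (Sum.inr (l, l₂))) =>
      cTwo b (posLT π k) * (2 * (((posLT π k ∩ b).card : ℤ)) * ((((posLT π k ∩ b).card : ℤ)) - 1)) *
        ((1 - pInd π k l) * (1 - pInd π k l₂))

theorem bigRowI_nonneg {lam : ℤ} {a : Finset (Fin n)} (hlam : 1 ≤ lam) (s) : 0 ≤ bigRowI lam a s := by
  have h0 := ind_nonneg a; have h1 := ind_le_one a
  rcases s with u | ⟨j, l, l'⟩ | ⟨l, l'⟩ | ⟨l, l₂⟩ <;> simp only [bigRowI]
  · norm_num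
  · exact bigRow_nonneg a j l l'
  · exact mul_nonneg (by linarith) (mul_nonneg (h0 l) (by linarith [h1 l']))
  · refine mul_nonneg (mul_nonneg (h0 l) (h0 l₂)) ?_
    split_ifs <;> linarith

theorem twoqq_nonneg (b P : Finset (Fin n)) : (0 : ℤ) ≤ 2 * ((P ∩ b).card : ℤ) * (((P ∩ b).card : ℤ) - 1) := by
  rcases Nat.eq_zero_or_pos (P ∩ b).card with h | h
  · simp [h]
  · have h1 : (1 : ℤ) ≤ ((P ∩ b).card : ℤ) := by exact_mod_cast h
    exact mul_nonneg (mul_nonneg (by norm_num) (by linarith)) (by linarith)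

theorem bigColI_nonneg (b : Finset (Fin n)) (π : Equiv.Perm (Fin n)) (k : ℕ) (s) : 0 ≤ bigColI b π k s := by
  have h0 := pInd_nonneg π k; have h1 := pInd_le_one π k
  have hc := cTwo_nonneg' b (posLT π k)
  have hqq := twoqq_nonneg b (posLT π k)
  rcases s with u | ⟨j, l, l'⟩ | ⟨l, l'⟩ | ⟨l, l₂⟩ <;> simp only [bigColI]
  · refine mul_nonneg hc ?_
    rcases Nat.eq_zero_or_pos (posLT π k ∩ b).card with h | h
    · simp [h]
    · have h1' : (1 : ℤ) ≤ ((posLT π k ∩ b).card : ℤ) := by exact_mod_cast h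
      exact mul_nonneg (by linarith) (by linarith)
  · exact bigCol_w_nonneg b (posLT π k) j l l'
  · refine mul_nonneg (mul_nonneg hc hqq) (mul_nonneg ?_ (invInd_nonneg π l l'))
    nlinarith [h0 l, h1 l, h0 l', h1 l', mul_nonneg (h0 l) (h0 l'),
      mul_nonneg (by linarith [h1 l] : (0:ℤ) ≤ 1 - pInd π k l) (by linarith [h1 l'] : (0:ℤ) ≤ 1 - pInd π k l')]
  · exact mul_nonneg (mul_nonneg hc hqq) (mul_nonneg (by linarith [h1 l]) (by linarith [h1 l₂]))

/-- ★★ **THE LARGE-CLASS PERMUTAHEDRAL IDENTITY** (all `n`, all `λ`, every row `a` and column `(b, π)`; `P = P_{|a|}(π)`, `q = |P∩b|`):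
`[q ≥ 2]·2q(q−1)·((1 − |a∩b|)² + λ·inv(a;π)) = [q ≥ 2]·(q(q−1) + Σ six pair families)`   (`big_core` at the unit weak relief)
` + [q ≥ 2]·2q(q−1)·Σ_{l,l′} λX_l(1−X_{l′})·([l,l′ ∉ P] + [l,l′ ∈ P])[π(l′)<π(l)]`   (inversions inside `Pᶜ×Pᶜ` and `P×P`)
` + [q ≥ 2]·2q(q−1)·Σ_{l,l₂} X_lX_{l₂}(λ − [l=l₂])·[l ∉ P][l₂ ∉ P]`   (`λd² − d`). -/
theorem bigInv_identity (lam : ℤ) (a b : Finset (Fin n)) (π : Equiv.Perm (Fin n)) :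
    cTwo b (posLT π a.card) * (2 * (((posLT π a.card ∩ b).card : ℤ)) * ((((posLT π a.card ∩ b).card : ℤ)) - 1)) *
        ((1 - ((a ∩ b).card : ℤ)) ^ 2 + lam * inv a π) =
      (cTwo b (posLT π a.card) * ((((posLT π a.card ∩ b).card : ℤ)) * ((((posLT π a.card ∩ b).card : ℤ)) - 1)) +
        ∑ j : Fin 6, ∑ l, ∑ l', bigRow a j l l' *
          (cTwo b (posLT π a.card) * bigCol (((posLT π a.card ∩ b).card : ℤ)) b (posLT π a.card) j l l')) +
      ((∑ l, ∑ l', (lam * (ind a l * (1 - ind a l'))) *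
          (cTwo b (posLT π a.card) * (2 * (((posLT π a.card ∩ b).card : ℤ)) * ((((posLT π a.card ∩ b).card : ℤ)) - 1)) *
            ((((1 - pInd π a.card l) * (1 - pInd π a.card l') + pInd π a.card l * pInd π a.card l') * invInd π l l')))) +
       (∑ l, ∑ l₂, (ind a l * ind a l₂ * (lam - (if l = l₂ then 1 else 0))) *
          (cTwo b (posLT π a.card) * (2 * (((posLT π a.card ∩ b).card : ℤ)) * ((((posLT π a.card ∩ b).card : ℤ)) - 1)) *
            ((1 - pInd π a.card l) * (1 - pInd π a.card l₂))))) := by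
  classical
  set P := posLT π a.card with hPdef
  set q : ℤ := ((P ∩ b).card : ℤ) with hqdef
  set w : ℤ := cTwo b P with hw
  have hkn : a.card ≤ n := by simpa using Finset.card_le_univ a
  have hPk : P.card = a.card := by rw [hPdef]; exact card_posLT π hkn
  have hX2 := ind_mul_self a
  have hP2 := pInd_mul_self π a.card
  have hPi : ∀ l, ind P l = pInd π a.card l := fun l => by rw [hPdef]; exact ind_posLT π a.card l
  have core := big_core_w w q a b P hPk hqdef
  -- (1) the recourse splits along `P`
  have hinv : inv a π = (∑ l, ind a l * (1 - pInd π a.card l)) * (∑ l, (1 - ind a l) * pInd π a.card l) +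
      ∑ l, ∑ l', ind a l * (1 - ind a l') *
        (((1 - pInd π a.card l) * (1 - pInd π a.card l') + pInd π a.card l * pInd π a.card l') * invInd π l l') := by
    have h := inv_split a π a.card
    simp only [lt, ← hPdef, hPi] at h
    exact h
  -- (2) the boundary family is `W·(λ x² − x)`, `x = Σ X_l (1 − Π_l)`, `W = w·2q(q−1)`
  set W : ℤ := w * (2 * q * (q - 1)) with hW
  have hbd : ∑ l, ∑ l₂, (ind a l * ind a l₂ * (lam - (if l = l₂ then 1 else 0))) *
        (W * ((1 - pInd π a.card l) * (1 - pInd π a.card l₂))) =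
      W * (lam * (∑ l, ind a l * (1 - pInd π a.card l)) ^ 2 - ∑ l, ind a l * (1 - pInd π a.card l)) := by
    have e : ∀ l l₂, (ind a l * ind a l₂ * (lam - (if l = l₂ then 1 else 0))) *
        (W * ((1 - pInd π a.card l) * (1 - pInd π a.card l₂))) =
        W * (lam * ((ind a l * (1 - pInd π a.card l)) * (ind a l₂ * (1 - pInd π a.card l₂)))) -
          W * (if l = l₂ then (ind a l * (1 - pInd π a.card l)) * (ind a l₂ * (1 - pInd π a.card l₂)) else 0) := by
      intro l l₂; split_ifs <;> ring
    have idem : ∀ l, (ind a l * (1 - pInd π a.card l)) * (ind a l * (1 - pInd π a.card l)) = ind a l * (1 - pInd π a.card l) := by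
      intro l
      linear_combination ((1 - pInd π a.card l) * (1 - pInd π a.card l)) * hX2 l + ind a l * hP2 l
    have inner : ∀ l, ∑ l₂, (ind a l * ind a l₂ * (lam - (if l = l₂ then 1 else 0))) *
        (W * ((1 - pInd π a.card l) * (1 - pInd π a.card l₂))) =
        W * (lam * ((ind a l * (1 - pInd π a.card l)) * ∑ l₂, ind a l₂ * (1 - pInd π a.card l₂))) -
          W * (ind a l * (1 - pInd π a.card l)) := by
      intro l
      rw [Finset.sum_congr rfl (fun l₂ _ => e l l₂), Finset.sum_sub_distrib, ← Finset.mul_sum, ← Finset.mul_sum,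
        ← Finset.mul_sum, ← Finset.mul_sum, Finset.sum_ite_eq]
      simp only [Finset.mem_univ, if_true]
      rw [idem l]
    rw [Finset.sum_congr rfl (fun l _ => inner l), Finset.sum_sub_distrib, ← Finset.mul_sum, ← Finset.mul_sum,
      ← Finset.mul_sum, ← Finset.sum_mul, sq]
    ring
  have hE : ∑ l, ∑ l', (lam * (ind a l * (1 - ind a l'))) *
        (W * ((((1 - pInd π a.card l) * (1 - pInd π a.card l') + pInd π a.card l * pInd π a.card l') * invInd π l l'))) =
      W * (lam * ∑ l, ∑ l', ind a l * (1 - ind a l') *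
        (((1 - pInd π a.card l) * (1 - pInd π a.card l') + pInd π a.card l * pInd π a.card l') * invInd π l l')) := by
    rw [Finset.mul_sum, Finset.mul_sum]
    refine Finset.sum_congr rfl fun l _ => ?_
    rw [Finset.mul_sum, Finset.mul_sum]
    exact Finset.sum_congr rfl fun l' _ => by ring
  rw [hinv, hbd, hE]
  -- (3) bookkeeping: x = |a| − |a∩P| = y, then `core`
  have sX := sum_ind a
  have sXP : ∑ l, ind a l * pInd π a.card l = ((a ∩ P).card : ℤ) := by
    simp_rw [← hPi]; exact sum_ind_mul a _
  have sP : ∑ l, pInd π a.card l = (P.card : ℤ) := by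
    simp_rw [← hPi]; exact sum_ind _
  have hx : ∑ l, ind a l * (1 - pInd π a.card l) = (a.card : ℤ) - ((a ∩ P).card : ℤ) := by
    rw [← sX, ← sXP, ← Finset.sum_sub_distrib]
    exact Finset.sum_congr rfl fun l _ => by ring
  have hy : ∑ l', (1 - ind a l') * pInd π a.card l' = (P.card : ℤ) - ((a ∩ P).card : ℤ) := by
    rw [← sP, ← sXP, ← Finset.sum_sub_distrib]
    exact Finset.sum_congr rfl fun l _ => by ring
  rw [hx, hy, hPk]
  linear_combination core

/-- the identity in packaged form for ONE row -/
theorem bigInv_identity' (lam : ℤ) (a b : Finset (Fin n)) (π : Equiv.Perm (Fin n)) :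
    cTwo b (posLT π a.card) * (2 * (((posLT π a.card ∩ b).card : ℤ)) * ((((posLT π a.card ∩ b).card : ℤ)) - 1)) *
        ((1 - ((a ∩ b).card : ℤ)) ^ 2 + lam * inv a π) =
      ∑ s, bigRowI lam a s * bigColI b π a.card s := by
  rw [bigInv_identity lam a b π]
  simp only [Fintype.sum_sum_type, Fintype.sum_prod_type, bigRowI, bigColI, Finset.sum_const, Finset.card_univ,
    Fintype.card_unit, one_smul, one_mul]
  ac_rfl

/-- index of the large-class certificate: one block per size class -/
abbrev BIdxK (n : ℕ) := Fin (n + 1) × BIdx n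

/-- ★★ **`rank₊([|P_{|a|}(π) ∩ b| ≥ 2]·((1 − |a∩b|)² + λ·inv(a;π))) ≤ (n+1)·|BIdx n|` for every `n` and every integer `λ ≥ 1`.** -/
theorem bigInv_rankPlus_le (n : ℕ) (lam : ℤ) (hlam : 1 ≤ lam) :
    ∃ (U : Finset (Fin n) → BIdxK n → ℝ) (V : Finset (Fin n) × Equiv.Perm (Fin n) → BIdxK n → ℝ),
      (∀ a s, 0 ≤ U a s) ∧ (∀ bπ s, 0 ≤ V bπ s) ∧
      ∀ (a b : Finset (Fin n)) (π : Equiv.Perm (Fin n)),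
        (cTwo b (posLT π a.card) : ℝ) * (((1 : ℝ) - ((a ∩ b).card : ℝ)) ^ 2 + (lam : ℝ) * (inv a π : ℝ)) =
          ∑ s, U a s * V (b, π) s := by
  classical
  refine ⟨fun a s => if (s.1 : ℕ) = a.card then (bigRowI lam a s.2 : ℝ) else 0,
    fun bπ s => (bigColI bπ.1 bπ.2 (s.1 : ℕ) s.2 : ℝ) /
      (2 * (((posLT bπ.2 (s.1 : ℕ) ∩ bπ.1).card : ℝ)) * ((((posLT bπ.2 (s.1 : ℕ) ∩ bπ.1).card : ℝ)) - 1)), ?_, ?_, ?_⟩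
  · intro a s
    dsimp only
    split_ifs
    · exact_mod_cast bigRowI_nonneg hlam s.2
    · exact le_rfl
  · intro bπ s
    dsimp only
    refine div_nonneg (by exact_mod_cast bigColI_nonneg bπ.1 bπ.2 _ s.2) ?_
    exact_mod_cast twoqq_nonneg bπ.1 (posLT bπ.2 (s.1 : ℕ))
  · intro a b π
    have hkn : a.card < n + 1 := by
      have : a.card ≤ n := by simpa using Finset.card_le_univ a
      omega
    -- the integer identity, cast to ℝ
    have h := congrArg (fun z : ℤ => (z : ℝ)) (bigInv_identity' lam a b π)
    simp only [Int.cast_add, Int.cast_pow, Int.cast_sub, Int.cast_one, Int.cast_mul, Int.cast_natCast, Int.cast_sum,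
      Int.cast_ofNat] at h
    rw [Fintype.sum_prod_type, Finset.sum_eq_single (⟨a.card, hkn⟩ : Fin (n + 1))]
    · simp only [if_true]
      set D : ℝ := 2 * (((posLT π a.card ∩ b).card : ℝ)) * ((((posLT π a.card ∩ b).card : ℝ)) - 1) with hD
      rcases cTwo_cases b (posLT π a.card) with h0 | h1
      · -- class `q ≤ 1`: both sides vanish
        have hV : ∀ s, (bigColI b π a.card s : ℝ) = 0 := by
          intro s
          rcases s with u | ⟨j, l, l'⟩ | ⟨l, l'⟩ | ⟨l, l₂⟩ <;> simp [bigColI, h0]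
        simp [h0, hV]
      · have hq := two_le_of_cTwo b (posLT π a.card) h1
        have hDpos : 0 < D := by
          have hq' : (2 : ℝ) ≤ ((posLT π a.card ∩ b).card : ℝ) := by exact_mod_cast hq
          rw [hD]; nlinarith
        have key : (cTwo b (posLT π a.card) : ℝ) * (((1 : ℝ) - ((a ∩ b).card : ℝ)) ^ 2 + (lam : ℝ) * (inv a π : ℝ)) =
            (∑ s, (bigRowI lam a s : ℝ) * (bigColI b π a.card s : ℝ)) / D := by
          rw [eq_div_iff hDpos.ne', ← h, hD]; ring
        rw [key, Finset.sum_div]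
        exact Finset.sum_congr rfl fun s _ => by rw [mul_div_assoc]
    · intro k _ hk
      have : (k : ℕ) ≠ a.card := fun e => hk (Fin.ext e)
      simp [this]
    · intro h'; exact absurd (Finset.mem_univ _) h'

/-- ★★★ **THE UNTILTED PERMUTAHEDRAL PENCIL IS BLIND FOR EVERY `λ ≥ 1`:**
`rank₊((1 − |a∩b|)² + λ·inv(a;π)) ≤ (n+1)·(|WIdx n| + 2n² + |BIdx n|) = O(n³)` for every `n` and every integer `λ ≥ 1` — nonnegative
`U`, `V` with `(1 − |a∩b|)² + λ·inv(a;π) = Σ_s U a s · V (b,π) s` for ALL rows `a ⊆ [n]` and ALL columns `(b, π)`.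
(§4 handles the columns with `|P_{|a|}(π) ∩ b| ≤ 1`, `bigInv_rankPlus_le` the others; `[q ≤ 1] + [q ≥ 2] = 1`.)
This supersedes §2 (`λ ≥ n+1`): the untilted small-λ residue is empty for integer `λ`. -/
theorem inv_rankPlus_le (n : ℕ) (lam : ℤ) (hlam : 1 ≤ lam) :
    ∃ (U : Finset (Fin n) → PIdx n ⊕ BIdxK n → ℝ) (V : Finset (Fin n) × Equiv.Perm (Fin n) → PIdx n ⊕ BIdxK n → ℝ),
      (∀ a s, 0 ≤ U a s) ∧ (∀ bπ s, 0 ≤ V bπ s) ∧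
      ∀ (a b : Finset (Fin n)) (π : Equiv.Perm (Fin n)),
        ((1 : ℝ) - ((a ∩ b).card : ℝ)) ^ 2 + (lam : ℝ) * (inv a π : ℝ) = ∑ s, U a s * V (b, π) s := by
  obtain ⟨U₁, V₁, hU₁, hV₁, h₁⟩ := smallInv_rankPlus_le n lam hlam
  obtain ⟨U₂, V₂, hU₂, hV₂, h₂⟩ := bigInv_rankPlus_le n lam hlam
  refine ⟨fun a s => Sum.elim (U₁ a) (U₂ a) s, fun bπ s => Sum.elim (V₁ bπ) (V₂ bπ) s, ?_, ?_, ?_⟩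
  · intro a s; rcases s with s | s
    · exact hU₁ a s
    · exact hU₂ a s
  · intro bπ s; rcases s with s | s
    · exact hV₁ bπ s
    · exact hV₂ bπ s
  · intro a b π
    rw [Fintype.sum_sum_type]
    simp only [Sum.elim_inl, Sum.elim_inr]
    rw [← h₁ a b π, ← h₂ a b π, ← add_mul]
    have hc : (cSmall b (posLT π a.card) : ℝ) + (cTwo b (posLT π a.card) : ℝ) = 1 := by
      exact_mod_cast cSmall_add_cTwo b (posLT π a.card)
    rw [hc, one_mul]

end BigClass

end Summit.ValiantsHypothesis.ValiantsHypothesis.Cruxes.NNDivisionHard.WeakReliefBlind39
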